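import Mathlib
import HarnessLib

/-!
# Feldman–Knörrer–Trubowitz, *Particle–Hole Ladders* (CMP 247 (2004) 179): §I objects and the headline bounds

Typer file F7a of the `gate-hubbard-kl` statements-first wave (D-0069 (2); DAG rows `PHL.*`,
HOME/DAG.tsv). Source: J. Feldman, H. Knörrer, E. Trubowitz, *Particle–Hole Ladders*, Commun. Math.
Phys. **247** (2004) 179–194, arXiv:math-ph/0209044 [FeldmanKnorrerTrubowitz2004Ladders]; locators
`p.N Ln` below are chunk `pNNNN.txt` line `n` of the materialised arXiv TeX (`lit read
arxiv:math-ph/0209044`), NOT printed pages; the stable locators are the paper's numbered items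
(Definition I.1 = `\defLADscales`, …, Theorem I.21 = `\thmLADmodcompLadder`, Theorem II.18 = `\bbound`;
we quote the TeX labels since the arXiv source numbers items by macro).

WHAT THIS PAPER PROVES (abstract, p.2): "the sum of all particle–hole ladder contributions for a two
dimensional, weakly coupled fermion gas with a strictly convex Fermi curve at temperature zero is
bounded" — uniformly in the infrared scale.  In the `gate-hubbard-kl` programme this is "C1's gain in
print" (DECOMP.md §2 C1 BetaSplit / App. E Lemma E.2): the particle–hole (wrong-way) ladders do not
drive an instability, so only the particle–particle (Cooper) channel has to be followed by a flow.

HYPOTHESIS SET (p.4 L85–89, kept DISTINCT from the FKT trilogy's, ref-2 trap (v)): the dispersion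
relation `e` is `C^{r_e+3}`, `r_e ≥ 6`, its gradient does not vanish on the Fermi curve
`F = {e = 0}`, and `F` is nonempty, connected, compact and strictly convex (curvature nowhere zero);
`r₀ ≥ 6` frequency derivatives are controlled.  NO strong-asymmetry hypothesis (that belongs to the
trilogy's Theorems I–III, typed by t3 in `FKTFermiLiquidOverview.lean`); the square-lattice Hubbard
dispersion on the programme's doping window satisfies THIS hypothesis set (tree:
`HubbardFermiBandCurvature`, strict convexity and curvature bounds for `-4 < μ < 0`), but nothing in
this file is instantiated at it.  Temperature zero, continuum `ℝ × ℝ²` (frequency–momentum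
`k = (k₀, 𝐤)`, position `x = (x₀, 𝐱)`).

DICTIONARY to Benfatto–Giuliani–Mastropietro 2006 (tree `AnisotropicSectors.scaleCutoffFn`,
`AngularSectors`, `SectorisedKernelNorm`): FKT's scale index `j ≥ 1` INCREASES towards the Fermi
curve, shell `j` ≈ `{|ik₀ - e(𝐤)| ~ M^{-j}}`, so `j = -h` and the scale parameter `M > 1` plays BGM's
`γ = 4`; FKT's sectors have length `𝔩_j = M^{-ℵ j}`, `1/2 < ℵ < 2/3` (BGM: `γ^{h/2}`, i.e. `ℵ = 1/2`,
excluded here); FKT's `L¹–L^∞` norms are continuum, zero-temperature analogues of the tree's torus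
norm `sectorisedKernelNorm` (which is NOT reused: different carrier, different cutoffs).  The
particle–PARTICLE analogue of the bubble of Theorem II.18 is the tree's
`Literature.Barriers.HubbardSuperconductivity.WeakCouplingCeiling.tendsto_cooperLadder_bubble`
(logarithmically divergent); the particle–HOLE objects below are new.

## Encoding (design choices, read before auditing)

* `SpT = ℝ × (Fin 2 → ℝ)` carries both momenta `k = (k₀, 𝐤)` (the set `𝔐` of the paper) and positions
  `x = (x₀, 𝐱)`; `⟨k, x⟩_- = -k₀x₀ + 𝐤·𝐱` (p.5 L61) is `mink`.
* The fixed data of §I ("we select, for each `j ≥ 1`, a sectorization `Σ_j` … and a partition of unity",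
  p.8 L29–33) are bundled in `LadderData`; their defining properties are the predicate
  `LadderData.Admissible` (nothing is asserted).  An interval `I` on the Fermi curve is recorded by
  `(a, l) : Arc` = (arclength start, length) relative to a fixed unit-speed parametrisation `γ` of `F`
  (`FermiFrame`), and the paper's projection `π_F` (p.4 L151; [FKTo3] = Feldman–Knörrer–Trubowitz,
  *Single scale analysis of many fermion systems, Part 3*, arXiv:math-ph/0209042, §XI: "an `r+d+1`
  times differentiable projection `π_F` to `F` in a neighbourhood of the Fermi surface") by its arclength
  parameter `πF : SpT → ℝ`.
* A function on the disjoint union `𝔜⁽⁴⁾_{Σ,Σ'} = ⊔_{i ∈ {0,1}⁴} 𝔜_{i₁,Σ} × 𝔜_{i₂,Σ} × 𝔜_{i₃,Σ'} × 𝔜_{i₄,Σ'}`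
  ((I.3), p.5 L29–38; `𝔜_{0,Σ} = 𝔐` momenta, `𝔜_{1,Σ} = (ℝ × ℝ²) × Σ` position–sector pairs) is
  `FourLegFn = (Fin 4 → Fin 2) → (Fin 4 → SpT) → (Fin 4 → Arc) → ℂ`: component `i`, continuous
  arguments `y` (`y μ` is the momentum `k_μ` if `i μ = 0` and the position `x_μ` if `i μ = 1`), sector
  labels `s` (read on position legs only).  Legs are indexed `0,1,2,3` for the paper's `1,2,3,4`.
  Spin (`(𝔜^↕_Σ)⁴`) is an extra argument `σ : Fin 4 → Fin 2` (`SpinFourLegFn`).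
* Norms take values in `ℝ≥0∞` (`∫⁻`, `⨆`), so every definition is total; the formal power series
  space `𝔑₃` of [FKTf2] (coefficients in `ℝ₊ ∪ {∞}`, p.7 L77–82) is `FPS3 = (Fin 3 → ℕ) → ℝ≥0∞` with the
  coefficientwise order, and `𝔠_j` ((I.17) `\eqnLADcj`, p.7 L84–89) is `cWeight`.
* Infinite sums over ladder lengths (Definition I.20) are `tsum`s (junk `0` if not summable — in the
  paper they converge by Theorem I.21 itself); the total Fourier transform `f̌` (Definition I.5 (ii)),
  printed through `(2π)³ δ(k₁-k₂-k₃+k₄)`, is realised by pinning one position leg at the origin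
  (`totalFT`), which is the printed `f̌` on the momentum-conservation surface for translation invariant
  `f` — the pinned leg's momentum coordinate is not read, so "sectorized" (Definition I.6,
  `IsSectorized`) tests the momenta of position legs for `k` ON that surface, `k 0 - k 1 - k 2 + k 3 = 0`
  (rev. 3 — revs. 1–2 tested every `k`, which through the unread coordinate of the pinned leg forced
  `f̌ ≡ 0`: cell finding S-t11-1, see `IsSectorized`); in the same way the all-momentum component
  (`i₁ = ⋯ = i₄ = 0`) of a ladder link, printed as a
  `(2π)³ δ(k₁-k₂-k₃+k₄)`-density (Definition I.7 (iii), p.6 L37–43), is realised by pinning the first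
  internal position at the origin (`linkPinned`, used by `link`; rev. 2 — in rev. 1 this component was an
  unpinned Bochner integral, identically `0` for translation invariant data: ref-2 defect F-072); the
  bubble-propagator sums `Σ_{i_b > j} C^{(i_b)}` of Definition II.17 are written in the closed
  form `C^{(≥ j+1)}` the paper itself uses ((II.2), p.9 L95–100).

## Contents and DAG rows

§I.2 scales/sectors `PHL.D.scales`, `PHL.D.sectors`; §I.3 `PHL.D.transinv`, `PHL.D.fourtrans`,
`PHL.D.sectorized`; §I.4 `PHL.D.phladder`; §I.5 `PHL.D.l1linf` (Definitions I.10–I.13),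
`PHL.D.normdom`; §I.6 propagators; §I.7 `PHL.D.resect`; §I.8 `PHL.D.cmpladder`; §II.2 `PHL.D.spin`;
§II.3 scaled norms (Definitions II.13/II.15, for the Bubble Bound); §II.4 `\topbottom`.
NAMED FACTS (D-0014, licences F-071, F-072, F-076 of HOME/FACT-LIST.md): `CompoundLadderBound`
(Theorem I.21 `\thmLADmodcompLadder`, the MAIN theorem), `CompoundLadderInfraredLimit` (Theorem I.22
`\thmLADmodcompLaddercont`), `BubbleBound` (Theorem II.18 `\bbound`); optional F-075
`ResectorizationNormBound` (Lemma II.16 `\lemLADresectornorm`).  NOT typed here (reported on STATUS):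
Lemma I.15 `\lemLADNormcomparison` (F-070; compares with the norms `|||·|||_{3,Σ}` and the particle–hole
value `V_ph` of [FKTf2]/[FKTf3], objects not in the tree), Proposition II.3 / Lemmas II.4–II.5
(F-073/F-074, wave-optional combinatorial identities), the Double Bubble Bound (no DAG row), Lemma II.7
(charge/spin representation; inside the DEF row `PHL.D.spin`, no licence — provable linear algebra, left
out).  No `instance`, no `notation`; nothing about the Hubbard model is asserted or denied.
-/

noncomputable section

open MeasureTheory Filter
open scoped Topology ENNReal

namespace Literature.MathematicalPhysics.QuantumLattice.FermiRG

namespace FKTLadders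

/-! ### §0 Carrier types -/

/-- Frequency–momentum points `k = (k₀, 𝐤) ∈ ℝ × ℝ²` (the set `𝔐` of the paper) and, by the same
type, space–time positions `x = (x₀, 𝐱) ∈ ℝ × ℝ²`. `PHL.D.transinv` · FKT-PHL §I.3 · p.5 L4–6.
[cite: FeldmanKnorrerTrubowitz2004Ladders, §I.3 (p.5)] -/
abbrev SpT : Type := ℝ × (Fin 2 → ℝ)

/-- The pairing `⟨k, x⟩_- = -k₀x₀ + 𝐤₁𝐱₁ + 𝐤₂𝐱₂`. `PHL.D.transinv` · FKT-PHL Definition I.4 · p.5 L61.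
[cite: FeldmanKnorrerTrubowitz2004Ladders, Definition I.4 (p.5 L61)] -/
def mink (k x : SpT) : ℝ := -(k.1 * x.1) + (k.2 0 * x.2 0 + k.2 1 * x.2 1)

/-- The `c`-th coordinate (`c = 0`: time/frequency, `c = 1, 2`: space/momentum) of a point of
`ℝ × ℝ²`; used for the monomials `x^δ = x₀^{δ₀} x₁^{δ₁} x₂^{δ₂}` (p.6 L129–133).
[cite: FeldmanKnorrerTrubowitz2004Ladders, §I.5 (p.6 L129–133)] -/
def coord (c : Fin 3) (x : SpT) : ℝ :=
  if c = 0 then x.1 else if c = 1 then x.2 0 else x.2 1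

/-- The unit vector of `ℝ × ℝ²` in coordinate direction `c`. [folklore] -/
def unitVec (c : Fin 3) : SpT :=
  if c = 0 then (1, 0) else if c = 1 then (0, Pi.single 0 1) else (0, Pi.single 1 1)

/-- The monomial `x^δ = x₀^{δ₀} x₁^{δ₁} x₂^{δ₂}` of a multi-index `δ ∈ ℕ₀ × ℕ₀²` (p.6 L129–133).
[cite: FeldmanKnorrerTrubowitz2004Ladders, §I.5 (p.6 L129–133)] -/
def monomial (δ : Fin 3 → ℕ) (x : SpT) : ℝ := ∏ c : Fin 3, coord c x ^ δ c

/-- `|δ| = δ₀ + δ₁ + δ₂` (p.6 L131). [cite: FeldmanKnorrerTrubowitz2004Ladders, §I.5 (p.6 L131)] -/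
def multiDeg (δ : Fin 3 → ℕ) : ℕ := ∑ c : Fin 3, δ c

/-- `δ! = δ₀! δ₁! δ₂!` (p.6 L131). [cite: FeldmanKnorrerTrubowitz2004Ladders, §I.5 (p.6 L131)] -/
def multiFactorial (δ : Fin 3 → ℕ) : ℕ := ∏ c : Fin 3, (δ c).factorial

/-- Spin labels `{↑, ↓}`. [cite: FeldmanKnorrerTrubowitz2004Ladders, §I.1 (p.3)] -/
abbrev Spin : Type := Fin 2

/-- An interval `I` on the Fermi curve, recorded as `(a, l)`: arclength start `a` and length `|I| = l`,
i.e. `I = γ([a, a + l])` for the fixed parametrisation `γ` of `FermiFrame`; also used as the LABEL of the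
sector `{k in the j-th neighbourhood : π_F(k) ∈ I}` it defines. `PHL.D.sectors` · FKT-PHL Definition I.2
· p.4 L144–150. [cite: FeldmanKnorrerTrubowitz2004Ladders, Definition I.2 (p.4 L144–150)] -/
abbrev Arc : Type := ℝ × ℝ

/-! ### §I.2 Scales and sectors (`PHL.D.scales`, `PHL.D.sectors`) -/

/-- The scale parameter `M > 1` and the bump `φ ∈ C₀^∞((-2,2))`, `φ ≡ 1` on `[-1,1]`, from which the
scale function `ν(x) = φ(x/M) - φ(Mx)` of (I.1) is built (p.3, p.4 L100–103). `PHL.D.scales` ·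
FKT-PHL (I.1) `\eqnLADpartofunity` + Definition I.1 · p.4 L94–103.
[cite: FeldmanKnorrerTrubowitz2004Ladders, Definition I.1 (p.4 L94–103)] -/
structure ScaleData where
  /-- the scale parameter `M > 1` -/
  M : ℝ
  /-- the bump `φ ∈ C₀^∞((-2,2))`, identically one on `[-1,1]` -/
  φ : ℝ → ℝ

/-- `ν(x) = φ(x/M) - φ(Mx)` for `x > 0` and zero otherwise (p.4 L100–103): the function of (I.1) with
`ν ∈ C₀^∞([1/M, 2M])`, values in `[0,1]`, `≡ 1` on `[2/M, M]`, `Σ_{j ≥ 0} ν(M^{2j}x) = 1` for `0 < x < 1`.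
`PHL.D.scales` · FKT-PHL (I.1)/Definition I.1 · p.4 L100–103.
[cite: FeldmanKnorrerTrubowitz2004Ladders, Definition I.1 (p.4 L100–103)] -/
def ScaleData.ν (S : ScaleData) (x : ℝ) : ℝ :=
  if 0 < x then S.φ (x / S.M) - S.φ (S.M * x) else 0

/-- The printed requirements on `M` and on the bump `φ` (p.3 before (I.1); p.4 L100–103): `M > 1`;
`φ` smooth, `[0,1]`-valued, identically one on `[-1,1]`, compactly supported in `(-2,2)`, and
non-increasing on `[0, ∞)` (so that `ν` is `[0,1]`-valued and monotone on `[1/M, 2/M]` and `[M, 2M]` as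
required before (I.1)). A predicate, never asserted. `PHL.D.scales` · FKT-PHL (I.1) · p.3–4.
[cite: FeldmanKnorrerTrubowitz2004Ladders, (I.1) and Definition I.1 (p.3, p.4 L94–103)] -/
structure ScaleData.Admissible (S : ScaleData) : Prop where
  one_lt_M : 1 < S.M
  smooth : ContDiff ℝ (⊤ : ℕ∞) S.φ
  mem_Icc : ∀ x, S.φ x ∈ Set.Icc (0 : ℝ) 1
  eq_one : ∀ x ∈ Set.Icc (-1 : ℝ) 1, S.φ x = 1
  tsupport_subset : tsupport S.φ ⊆ Set.Ioo (-2 : ℝ) 2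
  antitoneOn : AntitoneOn S.φ (Set.Ici 0)

/-- The Fermi curve `F = {𝐤 ∈ ℝ² : e(𝐤) = 0}` of a dispersion relation `e` (chemical potential absorbed,
p.3). `PHL.D.scales` · FKT-PHL §I.2 · p.4 L87. [cite: FeldmanKnorrerTrubowitz2004Ladders, §I.2 (p.4 L87)] -/
def fermiCurve (e : (Fin 2 → ℝ) → ℝ) : Set (Fin 2 → ℝ) := e ⁻¹' {0}

/-- Numerator `e_y² e_xx - 2 e_x e_y e_xy + e_x² e_yy` of the curvature `|…| / |∇e|³` of the level curve of
`e` through `q`; "strictly convex (meaning that its curvature does not vanish anywhere)" (p.4 L88) is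
`levelCurvatureNum e q ≠ 0` on `F` given `∇e ≠ 0`. [folklore] -/
def levelCurvatureNum (e : (Fin 2 → ℝ) → ℝ) (q : Fin 2 → ℝ) : ℝ :=
  let ex := fderiv ℝ e q (Pi.single 0 1)
  let ey := fderiv ℝ e q (Pi.single 1 1)
  let H : (Fin 2 → ℝ) → (Fin 2 → ℝ) → ℝ := fun u v => iteratedFDeriv ℝ 2 e q ![u, v]
  ey ^ 2 * H (Pi.single 0 1) (Pi.single 0 1) - 2 * ex * ey * H (Pi.single 0 1) (Pi.single 1 1)
    + ex ^ 2 * H (Pi.single 1 1) (Pi.single 1 1)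

/-- **The standing hypotheses of the paper on the dispersion relation** (p.4 L85–89): `e ∈ C^{r_e+3}`
with `r_e ≥ 6`; `∇e ≠ 0` on `F = {e = 0}`; `F` nonempty, connected, compact and strictly convex
(curvature nowhere zero); `r₀ ≥ 6` derivatives in `k₀` are controlled.  A Prop-valued predicate on
`(e, r_e, r₀)`, never asserted.  NB (ref-2 trap (v)): this is NOT the trilogy's hypothesis set — no
strong asymmetry is assumed; dispersion relations symmetric under `𝐤 ↦ -𝐤` are allowed. `PHL` header
row · FKT-PHL §I.2 · p.4 L85–89. [cite: FeldmanKnorrerTrubowitz2004Ladders, §I.2 (p.4 L85–89)] -/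
structure DispersionHyp (e : (Fin 2 → ℝ) → ℝ) (re r0 : ℕ) : Prop where
  six_le_re : 6 ≤ re
  six_le_r0 : 6 ≤ r0
  contDiff : ContDiff ℝ (re + 3 : ℕ) e
  fderiv_ne_zero : ∀ q ∈ fermiCurve e, fderiv ℝ e q ≠ 0
  nonempty : (fermiCurve e).Nonempty
  isConnected : IsConnected (fermiCurve e)
  isCompact : IsCompact (fermiCurve e)
  curvature_ne_zero : ∀ q ∈ fermiCurve e, levelCurvatureNum e q ≠ 0

variable (S : ScaleData) (e : (Fin 2 → ℝ) → ℝ)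

/-- **Definition I.1 (i)**, the `j`-th scale function `ν^{(j)}(k) = ν(M^{2j}(k₀² + e(𝐤)²))`, `j ≥ 1`.
`PHL.D.scales` · FKT-PHL Definition I.1 (i) · p.4 L94–99.
[cite: FeldmanKnorrerTrubowitz2004Ladders, Definition I.1 (i) (p.4 L94–99)] -/
def scaleFn (j : ℕ) (k : SpT) : ℝ := S.ν (S.M ^ (2 * j) * (k.1 ^ 2 + e k.2 ^ 2))

/-- **Definition I.1 (ii)** in its printed "equivalent" closed form:
`ν^{(≥ j)}(k) = φ(M^{2j-1}(k₀² + e(𝐤)²))` (`= Σ_{i ≥ j} ν^{(i)}(k)` off the Fermi surface, `= 1` on it).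
`PHL.D.scales` · FKT-PHL Definition I.1 (ii) · p.4 L116–122.
[cite: FeldmanKnorrerTrubowitz2004Ladders, Definition I.1 (ii) (p.4 L116–122)] -/
def nbhdFn (j : ℕ) (k : SpT) : ℝ := S.φ (S.M ^ ((2 * j : ℤ) - 1) * (k.1 ^ 2 + e k.2 ^ 2))

/-- The function `φ(M^{2j-2}(k₀² + e(𝐤)²))` whose support is the `j`-th extended neighbourhood
(Definition I.1 (ii), p.4 L131–135). `PHL.D.scales` · FKT-PHL Definition I.1 (ii) · p.4 L131.
[cite: FeldmanKnorrerTrubowitz2004Ladders, Definition I.1 (ii) (p.4 L131–135)] -/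
def extNbhdFn (j : ℕ) (k : SpT) : ℝ := S.φ (S.M ^ ((2 * j : ℤ) - 2) * (k.1 ^ 2 + e k.2 ^ 2))

/-- The `j`-th shell `= supp ν^{(j)}` ("The support of `ν^{(j)}` is called the `j`-th shell", contained in
`{M^{-j}/√M ≤ |ik₀ - e(𝐤)| ≤ √(2M) M^{-j}}`); a momentum is "of scale `j`" if it lies here.  We use the
open support `{ν^{(j)} ≠ 0}`. `PHL.D.scales` · FKT-PHL Definition I.1 (i) · p.4 L109–114.
[cite: FeldmanKnorrerTrubowitz2004Ladders, Definition I.1 (i) (p.4 L109–114)] -/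
def shell (j : ℕ) : Set SpT := Function.support (scaleFn S e j)

/-- The `j`-th neighbourhood of the Fermi surface `= supp ν^{(≥ j)}` (contained in
`{|ik₀ - e(𝐤)| ≤ √(2M) M^{-j}}`). `PHL.D.scales` · FKT-PHL Definition I.1 (ii) · p.4 L127–130.
[cite: FeldmanKnorrerTrubowitz2004Ladders, Definition I.1 (ii) (p.4 L127–130)] -/
def nbhd (j : ℕ) : Set SpT := Function.support (nbhdFn S e j)

/-- The `j`-th extended neighbourhood `= supp φ(M^{2j-2}(k₀² + e²))` (contained in
`{|ik₀ - e(𝐤)| ≤ √2 M · M^{-j}}`). `PHL.D.scales` · FKT-PHL Definition I.1 (ii) · p.4 L131–135.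
[cite: FeldmanKnorrerTrubowitz2004Ladders, Definition I.1 (ii) (p.4 L131–135)] -/
def extNbhd (j : ℕ) : Set SpT := Function.support (extNbhdFn S e j)

/-- The "second doubly extended neighbourhood" `{φ(M^{2·2-3}(k₀² + e²)) ≠ 0}` of [FKTo3] §XI
(arXiv:math-ph/0209042, p.2: `M` is chosen so large that it lies inside the region where `∇e ≠ 0` and the
projection `π_F` is defined and `C^{r_e+3}`); used only to state the regularity of the fixed projection.
[cite: FeldmanKnorrerTrubowitz2004Ladders, Definition I.2 (p.4 L151, "π_F is a projection on the Fermi surface")] -/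
def doublyExtNbhdTwo : Set SpT :=
  Function.support fun k : SpT => S.φ (S.M ^ (1 : ℤ) * (k.1 ^ 2 + e k.2 ^ 2))

/-- ENCODING DATUM for "interval on the Fermi surface", "length", "`π_F`" (Definition I.2, p.4 L144–151):
a period `len = length(F)`, a parametrisation `γ : ℝ → ℝ²` of `F` and the arclength parameter
`πF(k) ∈ ℝ` (mod `len`) of the paper's projection `π_F(k) ∈ F`, so that `π_F(k) = γ(πF k)`.  Its
defining properties are `FermiFrame.Admissible`. `PHL.D.sectors` · FKT-PHL Definition I.2 · p.4 L144–151.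
[cite: FeldmanKnorrerTrubowitz2004Ladders, Definition I.2 (p.4 L144–151)] -/
structure FermiFrame where
  /-- `length(F)` (p.4 L163–164) -/
  len : ℝ
  /-- unit-speed `len`-periodic parametrisation of the Fermi curve -/
  γ : ℝ → (Fin 2 → ℝ)
  /-- arclength parameter of the projection `π_F(k)` of `k` on the Fermi curve -/
  πF : SpT → ℝ

/-- The requirements tying a `FermiFrame` to the dispersion relation: `len > 0`; `γ` is `len`-periodic,
`C^{r_e+3}`, unit-speed (so parameter differences are arclengths), injective on `[0, len)` with range
exactly `F = {e = 0}`; `πF` restricted to `F` is the identity (`π_F` is a projection ON `F`, p.4 L151),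
and `k ↦ π_F(k) = γ(πF k)` is `C^{r_e+3}` on the second doubly extended neighbourhood ([FKTo3] §XI,
p.2).  Never asserted. `PHL.D.sectors` · FKT-PHL Definition I.2 · p.4 L151.
[cite: FeldmanKnorrerTrubowitz2004Ladders, Definition I.2 (p.4 L144–151)] -/
structure FermiFrame.Admissible (fr : FermiFrame) (S : ScaleData) (e : (Fin 2 → ℝ) → ℝ) (re : ℕ) :
    Prop where
  len_pos : 0 < fr.len
  periodic : Function.Periodic fr.γ fr.len
  contDiff : ContDiff ℝ (re + 3 : ℕ) fr.γ
  unit_speed : ∀ θ, deriv fr.γ θ 0 ^ 2 + deriv fr.γ θ 1 ^ 2 = 1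
  injOn : Set.InjOn fr.γ (Set.Ico 0 fr.len)
  range_eq : Set.range fr.γ = fermiCurve e
  proj_id : ∀ θ, ∃ n : ℤ, fr.πF ((0 : ℝ), fr.γ θ) = θ + n * fr.len
  proj_contDiffOn : ContDiffOn ℝ (re + 3 : ℕ) (fun k => fr.γ (fr.πF k)) (doublyExtNbhdTwo S e)

/-- `π_F(k) ∈ I` for the interval `I = (a, l)` on the Fermi curve: the arclength parameter of the
projection lies in `[a, a + l]` modulo the period. `PHL.D.sectors` · FKT-PHL Definition I.2 (i) · p.4 L148.
[cite: FeldmanKnorrerTrubowitz2004Ladders, Definition I.2 (i) (p.4 L146–151)] -/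
def FermiFrame.memArc (fr : FermiFrame) (I : Arc) (θ : ℝ) : Prop :=
  ∃ n : ℤ, θ + n * fr.len ∈ Set.Icc I.1 (I.1 + I.2)

/-- Arclength `|A ∩ F|` of the part of the Fermi curve (embedded at `k₀ = 0`) inside `A ⊆ ℝ × ℝ²`
(used in "`𝔩/16 ≤ |s ∩ s' ∩ F| ≤ 𝔩/8`", p.4 L160–161). `PHL.D.sectors` · FKT-PHL Definition I.2 (ii) ·
p.4 L160–161. [cite: FeldmanKnorrerTrubowitz2004Ladders, Definition I.2 (ii) (p.4 L160–161)] -/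
def FermiFrame.arcLengthIn (fr : FermiFrame) (A : Set SpT) : ℝ≥0∞ :=
  volume {θ : ℝ | θ ∈ Set.Ico 0 fr.len ∧ ((0 : ℝ), fr.γ θ) ∈ A}

variable (fr : FermiFrame)

/-- **Definition I.2 (i)**: the sector `s = {k in the j-th neighbourhood : π_F(k) ∈ I}` of length `|I|`
at scale `j` defined by the interval `I` on the Fermi curve. `PHL.D.sectors` · FKT-PHL Definition I.2 (i)
· p.4 L144–151. [cite: FeldmanKnorrerTrubowitz2004Ladders, Definition I.2 (i) (p.4 L144–151)] -/
def sector (j : ℕ) (I : Arc) : Set SpT := {k | k ∈ nbhd S e j ∧ fr.memArc I (fr.πF k)}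

/-- The extension `s̃ = {k in the j-th extended neighbourhood : π_F(k) ∈ s}` of a sector ([FKTo3]
Definition XII.1 (ii); it is the support allowed to sectorized functions in Definition I.6 below,
p.5 L118–119). `PHL.D.sectorized` · FKT-PHL Definition I.6 · p.5 L118–119.
[cite: FeldmanKnorrerTrubowitz2004Ladders, Definition I.6 (i) (p.5 L115–119)] -/
def extSector (j : ℕ) (I : Arc) : Set SpT := {k | k ∈ extNbhd S e j ∧ fr.memArc I (fr.πF k)}

/-- **Definition I.2 (ii)**: `Σ` is a sectorization of length `𝔩` at scale `j` — a (finite) set of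
sectors of length `𝔩` at scale `j` (here: of their defining intervals, `0 < 𝔩 < length(F)`) such that
the sectors cover the Fermi surface, each sector has precisely two neighbours in `Σ` (neighbours =
different sectors that intersect; "one to its left and one to its right"), and neighbours satisfy
`𝔩/16 ≤ |s ∩ s' ∩ F| ≤ 𝔩/8`.  (Then `|Σ| ≤ 2 length(F)/𝔩`, p.4 L163.) `PHL.D.sectors` · FKT-PHL
Definition I.2 (ii) · p.4 L154–164. [cite: FeldmanKnorrerTrubowitz2004Ladders, Definition I.2 (ii) (p.4 L154–164)] -/
structure IsSectorization (j : ℕ) (𝔩 : ℝ) (Γ : Finset Arc) : Prop where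
  length_eq : ∀ I ∈ Γ, I.2 = 𝔩
  length_pos : 0 < 𝔩
  length_lt : 𝔩 < fr.len
  covers : ∀ q ∈ fermiCurve e, ∃ I ∈ Γ, ((0 : ℝ), q) ∈ sector S e fr j I
  two_neighbours : ∀ I ∈ Γ,
    {I' : Arc | I' ∈ Γ ∧ I' ≠ I ∧ (sector S e fr j I ∩ sector S e fr j I').Nonempty}.ncard = 2
  overlap : ∀ I ∈ Γ, ∀ I' ∈ Γ, I' ≠ I → (sector S e fr j I ∩ sector S e fr j I').Nonempty →
    ENNReal.ofReal (𝔩 / 16) ≤ fr.arcLengthIn (sector S e fr j I ∩ sector S e fr j I') ∧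
      fr.arcLengthIn (sector S e fr j I ∩ sector S e fr j I') ≤ ENNReal.ofReal (𝔩 / 8)

/-! ### §I.3 Functions on `𝔜⁽⁴⁾_{Σ,Σ'}`: translation invariance, Fourier transform, sectorized functions
(`PHL.D.transinv`, `PHL.D.fourtrans`, `PHL.D.sectorized`) -/

/-- Leg kinds `i = (i₁,…,i₄) ∈ {0,1}⁴` of (I.3): `0` = momentum leg (`𝔜_{0,Σ} = 𝔐`), `1` = position leg
(`𝔜_{1,Σ} = (ℝ × ℝ²) × Σ`). `PHL.D.transinv` · FKT-PHL (I.3) `\eqnLADfourdunion` · p.5 L29–38.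
[cite: FeldmanKnorrerTrubowitz2004Ladders, (I.3) (p.5 L29–38)] -/
abbrev LegKind : Type := Fin 4 → Fin 2

/-- A function on the disjoint union `𝔜⁽⁴⁾_{Σ,Σ'}` ((I.3), p.5 L21–38): for each leg-kind vector `i` its
restriction `f|_{(i₁,…,i₄)}`, as a function of the continuous arguments `y` (momenta on momentum legs,
positions on position legs) and the sector labels `s` (meaningful on position legs only; legs `0,1`
carry labels from `Σ`, legs `2,3` from `Σ'`). `PHL.D.transinv` · FKT-PHL §I.3 · p.5 L21–38.
[cite: FeldmanKnorrerTrubowitz2004Ladders, §I.3 (I.3) (p.5 L21–38)] -/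
abbrev FourLegFn : Type := LegKind → (Fin 4 → SpT) → (Fin 4 → Arc) → ℂ

/-- A function on `(𝔜^↕_Σ)⁴` (legs carrying a spin in `{↑,↓}`, p.5 L2–8, p.5 L70–73): a spin assignment
`σ` on top of a `FourLegFn`. `PHL.D.transinv` · FKT-PHL §I.3 · p.5 L70–73.
[cite: FeldmanKnorrerTrubowitz2004Ladders, §I.3 (p.5 L70–73)] -/
abbrev SpinFourLegFn : Type := (Fin 4 → Spin) → FourLegFn

/-- A function `p((x,s),(x',s'))` on `((ℝ × ℝ²) × Σ)²` (the two-legged insertions of §I.6, p.8 L18–25, and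
of Definitions I.11/I.14 (i)). `PHL.D.normdom` · FKT-PHL §I.6 · p.8 L18–25.
[cite: FeldmanKnorrerTrubowitz2004Ladders, §I.6 (p.8 L18–25)] -/
abbrev TwoLegFn : Type := (Fin 2 → SpT) → (Fin 2 → Arc) → ℂ

/-- The exponent `b_μ` of (I.4): `b_μ = 0` for the creation legs `μ = 1, 4` and `b_μ = 1` for the
annihilation legs `μ = 2, 3` (here legs `0,3` resp. `1,2`). `PHL.D.transinv` · FKT-PHL (I.4) `\eqnLADbemu`
· p.5 L56–64. [cite: FeldmanKnorrerTrubowitz2004Ladders, (I.4) (p.5 L56–64)] -/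
def bExp (μ : Fin 4) : ℕ := if μ = 1 ∨ μ = 2 then 1 else 0

/-- The phase `e^{i(-1)^{b_μ} ⟨k, x⟩_-}` attached to leg `μ` (Definitions I.4 (ii), I.5 (i)).
[cite: FeldmanKnorrerTrubowitz2004Ladders, Definition I.4 (ii) (p.5 L52–55)] -/
def legPhase (μ : Fin 4) (k x : SpT) : ℂ :=
  Complex.exp (Complex.I * (-1 : ℂ) ^ bExp μ * (mink k x : ℂ))

/-- **Definition I.4 (i)**: the translation `T_t` — momentum legs unchanged, position legs shifted by `t`.
`PHL.D.transinv` · FKT-PHL Definition I.4 (i) · p.5 L40–47.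
[cite: FeldmanKnorrerTrubowitz2004Ladders, Definition I.4 (i) (p.5 L40–47)] -/
def translate (i : LegKind) (t : SpT) (y : Fin 4 → SpT) : Fin 4 → SpT :=
  fun μ => if i μ = 0 then y μ else y μ + t

/-- **Definition I.4 (ii), (iii)**: `f` on `𝔜⁽⁴⁾_{Σ,Σ'}` is translation invariant if every restriction
satisfies `f(T_t y₁,…,T_t y₄) = (∏_{μ : i_μ = 0} e^{i(-1)^{b_μ}⟨y_μ,t⟩_-}) f(y₁,…,y₄)` for all
`t ∈ ℝ × ℝ²`.  The second clause records that labels are only read on position legs (encoding).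
`PHL.D.transinv` · FKT-PHL Definition I.4 (ii)–(iii) · p.5 L48–68.
[cite: FeldmanKnorrerTrubowitz2004Ladders, Definition I.4 (ii)–(iii) (p.5 L48–68)] -/
def IsTranslationInvariant (f : FourLegFn) : Prop :=
  (∀ (i : LegKind) (t : SpT) (y : Fin 4 → SpT) (s : Fin 4 → Arc),
      f i (translate i t y) s = (∏ μ : Fin 4, if i μ = 0 then legPhase μ (y μ) t else 1) * f i y s) ∧
    ∀ (i : LegKind) (y : Fin 4 → SpT) (s s' : Fin 4 → Arc),
      (∀ μ, i μ = 1 → s μ = s' μ) → f i y s = f i y s'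

/-- Translation invariance of a function on `(𝔜^↕_Σ)⁴`: each spin component is translation invariant
(p.5 L70–73). `PHL.D.transinv` · FKT-PHL Definition I.4 (iii) · p.5 L70–73.
[cite: FeldmanKnorrerTrubowitz2004Ladders, Definition I.4 (iii) (p.5 L70–73)] -/
def IsTranslationInvariantSpin (F : SpinFourLegFn) : Prop := ∀ σ, IsTranslationInvariant (F σ)

/-- **Definition I.5 (i)**: the Fourier transform `Φ_μ` in the (position) leg `μ`,
`(Φ_μ f)(…,(k,s),…) = ∫ e^{i(-1)^{b_μ}⟨k,x⟩_-} f(…,(x,s),…) d³x`; afterwards `y μ` holds the momentum `k`.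
`PHL.D.fourtrans` · FKT-PHL Definition I.5 (i) · p.5 L76–94.
[cite: FeldmanKnorrerTrubowitz2004Ladders, Definition I.5 (i) (p.5 L76–94)] -/
def legFT (μ : Fin 4) (g : (Fin 4 → SpT) → ℂ) : (Fin 4 → SpT) → ℂ :=
  fun y => ∫ x : SpT, legPhase μ (y μ) x * g (Function.update y μ x)

/-- **Definition I.5 (ii)**, the total Fourier transform `f̌`: in print
`f̌(y) (2π)³ δ(k₁-k₂-k₃+k₄) = (∏_{μ : i_μ=1} Φ_μ f)(y)`; for translation invariant `f` this is realised by
pinning one position leg `μ₀` (chosen by `Exists.choose`; for translation invariant `f` the result on the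
conservation surface does not depend on the choice) at the origin and Fourier transforming the remaining
position legs, which gives `f̌` on the momentum-conservation surface `k₁-k₂ = k₃-k₄` (where alone it is
defined, p.5 L106–108).  If there is no position leg, `f̌ = f`.  NB: the momentum `k μ₀` of the pinned leg
is NOT READ — the value at `k` is `f̌` at the surface point whose `μ₀`-momentum is the conserved one,
`Σ_μ (-1)^{b_μ} k_μ = 0`, i.e. (legs `0,…,3`) `k 0 - k 1 - k 2 + k 3 = 0`; any condition on "the momentum of
leg `μ₀`" must therefore be stated for `k` ON that surface (see `IsSectorized`, rev. 3).
`PHL.D.fourtrans` · FKT-PHL Definition I.5 (ii) · p.5 L95–108.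
[cite: FeldmanKnorrerTrubowitz2004Ladders, Definition I.5 (ii) (p.5 L95–108)] -/
def totalFT (i : LegKind) (g : (Fin 4 → SpT) → ℂ) : (Fin 4 → SpT) → ℂ := fun k =>
  if h : ∃ μ : Fin 4, i μ = 1 then
    let μ₀ : Fin 4 := h.choose
    ∫ x : ({μ : Fin 4 // i μ = 1 ∧ μ ≠ μ₀} → SpT),
      (∏ μ : {μ : Fin 4 // i μ = 1 ∧ μ ≠ μ₀}, legPhase μ.1 (k μ.1) (x μ)) *
        g (fun μ => if h' : i μ = 1 ∧ μ ≠ μ₀ then x ⟨μ, h'⟩ else if μ = μ₀ then 0 else k μ)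
  else g k

/-- **Definition I.6**: `f` on `𝔜⁽⁴⁾_{Σ,Σ'}` (left sectorization `Σ` at scale `jl`, right `Σ'` at scale
`jr`) is sectorized if, for each position leg `μ`, the total Fourier transform `f̌(…,(k,s_μ),…)` vanishes
unless `k` is in the extended neighbourhood (of the leg's scale) and `π_F(k) ∈ s_μ`, i.e. unless `k`
lies in the extended sector `s̃_μ`.  `f̌` lives on the momentum-conservation surface (Definition I.5 (ii),
p.5 L106–108), so the test momenta `k` range over that surface, `k 0 - k 1 - k 2 + k 3 = 0`
(`Σ_μ (-1)^{b_μ} k_μ = 0` with (I.4)); there the momentum of every position leg — including the pinned leg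
`μ₀` of `totalFT`, whose coordinate `k μ₀` is not read but is determined by the other three — is the printed
one.  Rev. 3 (cell gate-hubbard-kl, hubbard-kl-t11 finding S-t11-1, 2026-08-26): revs. 1–2 quantified over
ALL `k : Fin 4 → SpT` without the surface guard; since `totalFT` ignores `k μ₀` and extended sectors are
proper subsets of `ℝ × ℝ²` for admissible data, the clause `μ = μ₀` then forced `f̌ ≡ 0` on every component
with a position leg (kernel-checked: the unguarded predicate implies `totalFT i (f i · s) k = 0` for all
`k`), making `IsSectorized` — and with it the hypotheses of `CompoundLadderBound`,
`CompoundLadderInfraredLimit`, `ResectorizationNormBound`, `BubbleBound` — degenerate.  With the guard the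
clauses `μ ≠ μ₀` are equivalent to the unguarded ones (the free coordinate `k μ₀` can always be moved onto
the surface without changing `totalFT`), and the clause `μ = μ₀` is the printed condition on the conserved
momentum. `PHL.D.sectorized` · FKT-PHL Definition I.6 · p.5 L110–128.
[cite: FeldmanKnorrerTrubowitz2004Ladders, Definition I.6 (p.5 L110–128) with Definition I.5 (ii) (p.5 L95–108)] -/
def IsSectorized (jl jr : ℕ) (f : FourLegFn) : Prop :=
  ∀ (i : LegKind) (k : Fin 4 → SpT) (s : Fin 4 → Arc) (μ : Fin 4), i μ = 1 →
    k 0 - k 1 - k 2 + k 3 = 0 →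
      k μ ∉ extSector S e fr (if μ.val < 2 then jl else jr) (s μ) → totalFT i (fun y => f i y s) k = 0

/-- Sectorized-ness of a function on `(𝔜^↕_Σ)⁴`: every spin component is sectorized (p.5 L124–127).
`PHL.D.sectorized` · FKT-PHL Definition I.6 (ii) · p.5 L124–127.
[cite: FeldmanKnorrerTrubowitz2004Ladders, Definition I.6 (ii) (p.5 L124–127)] -/
def IsSectorizedSpin (jl jr : ℕ) (F : SpinFourLegFn) : Prop := ∀ σ, IsSectorized S e fr jl jr (F σ)

/-- The Fourier transform of a two-legged sectorized function with fixed labels: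
`∫ d³x e^{i⟨k,x⟩_-} p((0,s),(x,s'))` (p.8 L21–24, summand). `PHL.D.phladder` · FKT-PHL §I.6 · p.8 L21–24.
[cite: FeldmanKnorrerTrubowitz2004Ladders, §I.6 (p.8 L18–25)] -/
def twoLegFTAt (p : TwoLegFn) (s s' : Arc) (k : SpT) : ℂ :=
  ∫ x : SpT, Complex.exp (Complex.I * (mink k x : ℂ)) * p ![0, x] ![s, s']

/-- **§I.6, p.8 L21–24**: `p̌(k) = Σ_{s,s' ∈ Σ} ∫ d³x e^{i⟨k,x⟩_-} p((0,s),(x,s'))`, the Fourier transform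
of a sectorized, translation invariant two-legged function (the functions `v = Σ p̌^{(i)}` entering the
propagators). `PHL.D.phladder` · FKT-PHL §I.6 · p.8 L18–25.
[cite: FeldmanKnorrerTrubowitz2004Ladders, §I.6 (p.8 L18–25)] -/
def twoLegFT (Γ : Finset Arc) (p : TwoLegFn) (k : SpT) : ℂ :=
  ∑ s ∈ Γ, ∑ s' ∈ Γ, twoLegFTAt p s s' k

/-- Translation invariance of a two-legged function, `p((x+t,s),(x'+t,s')) = p((x,s),(x',s'))` (the
two-legged case of Definition I.4; p.8 L18–19 "sectorized, translation invariant functions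
`p((x,s),(x,s'))`"). `PHL.D.transinv` · FKT-PHL §I.6 · p.8 L18–19.
[cite: FeldmanKnorrerTrubowitz2004Ladders, Definition I.4 and §I.6 (p.8 L18–19)] -/
def TwoLeg.IsTranslationInvariant (p : TwoLegFn) : Prop :=
  ∀ (t : SpT) (x : Fin 2 → SpT) (s : Fin 2 → Arc), p (fun a => x a + t) s = p x s

/-- Sectorized-ness of a two-legged function at scale `j` (the two-legged case of Definition I.6, as in
[FKTo3] Definition XII.2: the Fourier transform with labels `(s, s')` vanishes unless the momentum lies in
both extended sectors `s̃`, `s̃'`). `PHL.D.sectorized` · FKT-PHL Definition I.6 / §I.6 · p.8 L18–19.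
[cite: FeldmanKnorrerTrubowitz2004Ladders, Definition I.6 and §I.6 (p.8 L18–19)] -/
def TwoLeg.IsSectorized (j : ℕ) (p : TwoLegFn) : Prop :=
  ∀ (s s' : Arc) (k : SpT), (k ∉ extSector S e fr j s ∨ k ∉ extSector S e fr j s') →
    twoLegFTAt p s s' k = 0

/-! ### §I.4 Particle–hole ladders (`PHL.D.phladder`) -/

/-- **Definition I.7 (i)**: a (spin independent) propagator is a translation invariant function `A(x,x')`
on `(ℝ × ℝ²)²`. `PHL.D.phladder` · FKT-PHL Definition I.7 (i) · p.6 L1–3.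
[cite: FeldmanKnorrerTrubowitz2004Ladders, Definition I.7 (i) (p.6 L1–3)] -/
abbrev Propagator : Type := SpT → SpT → ℂ

/-- **Definition I.7 (ii)**: a bubble propagator is a translation invariant function `P(x₁,x₂,x₃,x₄)` on
`(ℝ × ℝ²)⁴`. `PHL.D.phladder` · FKT-PHL Definition I.7 (ii) · p.6 L4.
[cite: FeldmanKnorrerTrubowitz2004Ladders, Definition I.7 (ii) (p.6 L4)] -/
abbrev BubblePropagator : Type := (Fin 4 → SpT) → ℂ

/-- The transpose `Aᵗ(x,x') = A(x',x)` (Definition I.7 (i)). `PHL.D.phladder` · FKT-PHL Definition I.7 (i)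
· p.6 L3. [cite: FeldmanKnorrerTrubowitz2004Ladders, Definition I.7 (i) (p.6 L3)] -/
def Propagator.transpose (A : Propagator) : Propagator := fun x x' => A x' x

/-- `A ⊗ B (x₁,x₂,x₃,x₄) = A(x₁,x₃) B(x₂,x₄)` (Definition I.7 (ii)). `PHL.D.phladder` · FKT-PHL
Definition I.7 (ii) · p.6 L5–8. [cite: FeldmanKnorrerTrubowitz2004Ladders, Definition I.7 (ii) (p.6 L5–8)] -/
def tensorBubble (A B : Propagator) : BubblePropagator := fun x => A (x 0) (x 2) * B (x 1) (x 3)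

/-- **Definition I.7 (ii)**: the particle–hole bubble propagator
`𝒞(A,B) = (A+B) ⊗ (A+B)ᵗ - B ⊗ Bᵗ = A ⊗ Aᵗ + A ⊗ Bᵗ + B ⊗ Aᵗ` (at least one "hard" line `A`, Remark I.8).
`PHL.D.phladder` · FKT-PHL Definition I.7 (ii) · p.6 L9–15.
[cite: FeldmanKnorrerTrubowitz2004Ladders, Definition I.7 (ii) (p.6 L9–15)] -/
def bubbleC (A B : Propagator) : BubblePropagator :=
  tensorBubble A A.transpose + tensorBubble A B.transpose + tensorBubble B A.transpose

/-- The integrand of one ladder link `K₁ • P • K₂` (Definition I.7 (iii)) at the internal positions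
`z = (x'₁, x'₂, x₁, x₂)`: `K₁|_{(i₁,i₂,1,1)}(y₁,y₂,(x'₁,s'₁),(x'₂,s'₂)) P(x'₁,x'₂;x₁,x₂)
K₂|_{(1,1,i₃,i₄)}((x₁,s₁),(x₂,s₂),y₃,y₄)` for the external leg kinds `i`, external arguments `y`, external
labels `s` and internal labels `s'₁, s'₂` (right legs of `K₁`), `s₁, s₂` (left legs of `K₂`).
`PHL.D.phladder` · FKT-PHL Definition I.7 (iii) · p.6 L17–43.
[cite: FeldmanKnorrerTrubowitz2004Ladders, Definition I.7 (iii) (p.6 L17–43)] -/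
def linkIntegrand (K₁ : FourLegFn) (P : BubblePropagator) (K₂ : FourLegFn) (i : LegKind)
    (y : Fin 4 → SpT) (s : Fin 4 → Arc) (s'₁ s'₂ s₁ s₂ : Arc) (z : Fin 4 → SpT) : ℂ :=
  K₁ ![i 0, i 1, 1, 1] ![y 0, y 1, z 0, z 1] ![s 0, s 1, s'₁, s'₂] * P ![z 0, z 1, z 2, z 3] *
    K₂ ![1, 1, i 2, i 3] ![z 2, z 3, y 2, y 3] ![s₁, s₂, s 2, s 3]

/-- **Definition I.7 (iii), the case `i₁ = i₂ = i₃ = i₄ = 0`** (p.6 L37–43): when all four external legs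
are momentum legs, print defines the link as a DENSITY on the momentum-conservation surface,
`(F • K)(k₁,k₂,k₃,k₄) (2π)³ δ(k₁-k₂-k₃+k₄) = Σ_{s₁,s₂} ∫ dx₁dx₂ F(k₁,k₂;x₁,x₂) K((x₁,s₁),(x₂,s₂),k₃,k₄)`.
For translation invariant rungs and bubble propagator the unpinned integrand
`z ↦ linkIntegrand … 0 k s … z` only picks up the phase `e^{i⟨(k₁-k₂)-(k₃-k₄), t⟩_-}` under the diagonal
shift `z ↦ z + (t,t,t,t)` (Definition I.4 (ii) with (I.4)), so — exactly as `totalFT` realises the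
`(2π)³ δ` of Definition I.5 (ii) — the printed density is obtained by PINNING one internal position, here
the first one `x'₁`, at the origin and integrating the remaining three.  On the conservation surface
`k₁-k₂ = k₃-k₄` (the only place where print defines this component, cf. p.5 L106–108) this is the printed
`(F • K)(k₁,…,k₄)` (independent of which internal position is pinned); off the surface it is the
extension given by the same formula (encoding; print leaves the component undefined there).
Rev. 2 (ref-2 tier-1 audit 2026-08-26, defect F-072: the former unpinned `∫ z : Fin 4 → SpT` of this
component was the Bochner integral of a function whose modulus is constant along the diagonal, hence `0`).
`PHL.D.phladder` · FKT-PHL Definition I.7 (iii) · p.6 L37–43.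
[cite: FeldmanKnorrerTrubowitz2004Ladders, Definition I.7 (iii) (p.6 L37–43)] -/
def linkPinned (K₁ : FourLegFn) (P : BubblePropagator) (K₂ : FourLegFn) (k : Fin 4 → SpT)
    (s : Fin 4 → Arc) (s'₁ s'₂ s₁ s₂ : Arc) : ℂ :=
  ∫ z : Fin 3 → SpT, linkIntegrand K₁ P K₂ 0 k s s'₁ s'₂ s₁ s₂ ![0, z 0, z 1, z 2]

/-- **Definition I.7 (iii)–(iv)**, one ladder link `K₁ • P • K₂`: the right position legs of the rung `K₁`
(labels summed over `ΓR`) and the left position legs of `K₂` (labels summed over `ΓL`) are integrated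
against the bubble propagator: `Σ_{s'₁,s'₂ ∈ ΓR} Σ_{s₁,s₂ ∈ ΓL} ∫ dx'₁dx'₂dx₁dx₂ K₁(y₁,y₂,(x'₁,s'₁),(x'₂,s'₂))
P(x'₁,x'₂;x₁,x₂) K₂((x₁,s₁),(x₂,s₂),y₃,y₄)`; the external legs keep their kinds (component `i` of the
link uses `K₁|_{(i₁,i₂,1,1)}` and `K₂|_{(1,1,i₃,i₄)}`).  When at least one external leg is a position leg
(`i ≠ 0`) this is the plain integral over the four internal positions (p.6 L22–36); when all four
external legs are momentum legs (`i = 0`) it is the `(2π)³ δ(k₁-k₂-k₃+k₄)`-density of p.6 L37–43,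
realised by the pinned integral `linkPinned` (see there).  `PHL.D.phladder` · FKT-PHL Definition I.7
(iii)–(iv) · p.6 L17–80. [cite: FeldmanKnorrerTrubowitz2004Ladders, Definition I.7 (iii)–(iv) (p.6 L17–80)] -/
def link (ΓR ΓL : Finset Arc) (K₁ : FourLegFn) (P : BubblePropagator) (K₂ : FourLegFn) : FourLegFn :=
  fun i y s =>
    ∑ s'₁ ∈ ΓR, ∑ s'₂ ∈ ΓR, ∑ s₁ ∈ ΓL, ∑ s₂ ∈ ΓL,
      if i = 0 then linkPinned K₁ P K₂ y s s'₁ s'₂ s₁ s₂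
      else ∫ z : Fin 4 → SpT, linkIntegrand K₁ P K₂ i y s s'₁ s'₂ s₁ s₂ z

/-- Unfolding of `link` on a component with at least one external position leg: the plain integral over
the four internal positions (Definition I.7 (iii), p.6 L22–36).
[cite: FeldmanKnorrerTrubowitz2004Ladders, Definition I.7 (iii) (p.6 L22–36)] -/
theorem link_apply_of_ne_zero (ΓR ΓL : Finset Arc) (K₁ : FourLegFn) (P : BubblePropagator)
    (K₂ : FourLegFn) {i : LegKind} (hi : i ≠ 0) (y : Fin 4 → SpT) (s : Fin 4 → Arc) :
    link ΓR ΓL K₁ P K₂ i y s =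
      ∑ s'₁ ∈ ΓR, ∑ s'₂ ∈ ΓR, ∑ s₁ ∈ ΓL, ∑ s₂ ∈ ΓL,
        ∫ z : Fin 4 → SpT, linkIntegrand K₁ P K₂ i y s s'₁ s'₂ s₁ s₂ z := by
  simp [link, hi]

/-- Unfolding of `link` on the all-momentum component `i = 0`: the pinned density of Definition I.7 (iii),
p.6 L37–43. [cite: FeldmanKnorrerTrubowitz2004Ladders, Definition I.7 (iii) (p.6 L37–43)] -/
theorem link_apply_zero (ΓR ΓL : Finset Arc) (K₁ : FourLegFn) (P : BubblePropagator) (K₂ : FourLegFn)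
    (k : Fin 4 → SpT) (s : Fin 4 → Arc) :
    link ΓR ΓL K₁ P K₂ 0 k s =
      ∑ s'₁ ∈ ΓR, ∑ s'₂ ∈ ΓR, ∑ s₁ ∈ ΓL, ∑ s₂ ∈ ΓL, linkPinned K₁ P K₂ k s s'₁ s'₂ s₁ s₂ := by
  simp [link]

/-- The same link for functions on `(𝔜^↕_Σ)⁴`: internal spins are summed,
`(F' • K')(σ₁,…,σ₄) = Σ_{τ₁,τ₂} F'(σ₁,σ₂,τ₁,τ₂) • K'(τ₁,τ₂,σ₃,σ₄)`, the bubble propagator being spin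
independent (p.6 L47–61). `PHL.D.phladder` · FKT-PHL Definition I.7 (iii) · p.6 L47–61.
[cite: FeldmanKnorrerTrubowitz2004Ladders, Definition I.7 (iii) (p.6 L47–61)] -/
def spinLink (ΓR ΓL : Finset Arc) (K₁ : SpinFourLegFn) (P : BubblePropagator) (K₂ : SpinFourLegFn) :
    SpinFourLegFn := fun σ i y s =>
  ∑ τ₁ : Spin, ∑ τ₂ : Spin, link ΓR ΓL (K₁ ![σ 0, σ 1, τ₁, τ₂]) P (K₂ ![τ₁, τ₂, σ 2, σ 3]) i y s

/-- **Definition I.7 (iv)**: the ladder `K₁ • P₁ • K₂ • P₂ • ⋯ • P_ℓ • K_{ℓ+1}` with rungs `K_m` and bubble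
propagators `P_m`; each further rung comes with the sectorizations (`ΓR` of the previous rung's right
legs, `ΓL` of its own left legs) over which the joint is summed. `PHL.D.phladder` · FKT-PHL Definition I.7
(iv) · p.6 L64–80. [cite: FeldmanKnorrerTrubowitz2004Ladders, Definition I.7 (iv) (p.6 L64–80)] -/
def ladder (K₁ : SpinFourLegFn) :
    List (Finset Arc × BubblePropagator × Finset Arc × SpinFourLegFn) → SpinFourLegFn
  | [] => K₁
  | (ΓR, P, ΓL, K) :: rest => ladder (spinLink ΓR ΓL K₁ P K) rest

/-! ### §I.5 Norms (`PHL.D.l1linf`, `PHL.D.normdom`) -/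

/-- **Definition I.10**, the `L¹–L^∞` norm of a function `g(x,y)` on `(ℝ × ℝ²)²`:
`max(sup_x ∫|g| dy, sup_y ∫|g| dx)` (the case `n = 2`, used for propagators and two-legged insertions).
`PHL.D.l1linf` · FKT-PHL Definition I.10 · p.6 L117–128.
[cite: FeldmanKnorrerTrubowitz2004Ladders, Definition I.10 (p.6 L117–128)] -/
def l1linfTwo (g : SpT → SpT → ℂ) : ℝ≥0∞ :=
  max (⨆ x : SpT, ∫⁻ y : SpT, ‖g x y‖₊) (⨆ y : SpT, ∫⁻ x : SpT, ‖g x y‖₊)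

/-- **Definition I.10** for the spatial arguments of a four-legged function: for the restriction to leg
kinds `i` (position legs `P = {μ : i_μ = 1}`), with the momentum legs frozen at `k`,
`‖h‖_{1,∞} = max_{μ₀ ∈ P} sup_{x_{μ₀}} ∫ ∏_{μ ∈ P, μ ≠ μ₀} dx_μ |h|`; with no position leg it is `|h(k)|`.
`PHL.D.l1linf` · FKT-PHL Definition I.10 · p.6 L117–128 (applied as in Definition I.13, p.7 L57–59).
[cite: FeldmanKnorrerTrubowitz2004Ladders, Definition I.10 (p.6 L117–128)] -/
def l1linfLegs (i : LegKind) (h : (Fin 4 → SpT) → ℂ) (k : Fin 4 → SpT) : ℝ≥0∞ :=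
  if ∃ μ : Fin 4, i μ = 1 then
    ⨆ (μ₀ : {μ : Fin 4 // i μ = 1}), ⨆ (x₀ : SpT),
      ∫⁻ x : ({μ : Fin 4 // i μ = 1 ∧ μ ≠ μ₀.1} → SpT),
        ‖h (fun μ => if h' : i μ = 1 ∧ μ ≠ μ₀.1 then x ⟨μ, h'⟩ else if μ = μ₀.1 then x₀ else k μ)‖₊
  else ‖h k‖₊

/-- **Definition I.11**: for `A` on `((ℝ × ℝ²) × Σ)²` and a multi-index `δ`,
`‖A‖^δ_{1,Σ} = max_{i=1,2} max_{s_i ∈ Σ} Σ_{s_{3-i} ∈ Σ} ‖(x-y)^δ A((x,s₁),(y,s₂))‖_{1,∞}`.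
`PHL.D.l1linf` · FKT-PHL Definition I.11 · p.6 L135–145.
[cite: FeldmanKnorrerTrubowitz2004Ladders, Definition I.11 (p.6 L135–145)] -/
def twoLegNormCoeff (Γ : Finset Arc) (δ : Fin 3 → ℕ) (A : TwoLegFn) : ℝ≥0∞ :=
  max (⨆ (s₁ : Arc) (_ : s₁ ∈ Γ), ∑ s₂ ∈ Γ,
      l1linfTwo fun x y => (monomial δ (x - y) : ℂ) * A ![x, y] ![s₁, s₂])
    (⨆ (s₂ : Arc) (_ : s₂ ∈ Γ), ∑ s₁ ∈ Γ,
      l1linfTwo fun x y => (monomial δ (x - y) : ℂ) * A ![x, y] ![s₁, s₂])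

/-- The elementary leg operator in coordinate `c` behind **Definition I.12 (i)**: on a momentum leg `μ` the
signed partial derivative `(-1)^{[c ≠ 0]} (-1)^{b_μ} i ∂/∂k_{μ,c}` (so that `δ` of them compose to
`D_μ^δ = (-1)^{δ₁+δ₂}(-1)^{b_μ|δ|} i^{|δ|} ∂^δ`, "multiplication by the `δ`-th power of the position variable
dual to `k_μ`"), on a position leg multiplication by the coordinate `x_{μ,c}`. `PHL.D.l1linf` · FKT-PHL
Definition I.12 (i) · p.7 L1–20. [cite: FeldmanKnorrerTrubowitz2004Ladders, Definition I.12 (i) (p.7 L1–20)] -/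
def legOp (i : LegKind) (μ : Fin 4) (c : Fin 3) (g : (Fin 4 → SpT) → ℂ) : (Fin 4 → SpT) → ℂ :=
  fun y =>
    if i μ = 0 then
      ((-1 : ℂ) ^ (if c = 0 then 0 else 1) * (-1 : ℂ) ^ bExp μ * Complex.I) *
        lineDeriv ℝ (fun q : SpT => g (Function.update y μ q)) (y μ) (unitVec c)
    else (coord c (y μ) : ℂ) * g y

/-- **Definition I.12**, the differential–decay operator `D^δ_{μ;μ'}`: the `δ`-th power of the difference
of the leg operators of legs `μ ≠ μ'` — `(D_μ - D_{μ'})^δ` on two momentum legs, `(D_μ - x_{μ'})^δ`,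
`(x_μ - D_{μ'})^δ` on mixed legs, `(x_μ - x_{μ'})^δ` on two position legs (coordinatewise powers; the leg
operators of different legs commute). `PHL.D.l1linf` · FKT-PHL Definition I.12 · p.7 L21–41.
[cite: FeldmanKnorrerTrubowitz2004Ladders, Definition I.12 (p.7 L21–41)] -/
def diffDecay (i : LegKind) (μ μ' : Fin 4) (δ : Fin 3 → ℕ) (g : (Fin 4 → SpT) → ℂ) :
    (Fin 4 → SpT) → ℂ :=
  (fun g => legOp i μ 0 g - legOp i μ' 0 g)^[δ 0]
    ((fun g => legOp i μ 1 g - legOp i μ' 1 g)^[δ 1]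
      ((fun g => legOp i μ 2 g - legOp i μ' 2 g)^[δ 2] g))

/-- Admissible label assignments for the norm of Definition I.13: position legs `0,1` carry labels from
`Σ`, position legs `2,3` from `Σ'`; momentum legs carry the dummy label `(0,0)` (labels are not read
there). [cite: FeldmanKnorrerTrubowitz2004Ladders, Definition I.13 (i) (p.7 L43–59)] -/
def AdmissibleLabels (Γl Γr : Finset Arc) (i : LegKind) (s : Fin 4 → Arc) : Prop :=
  ∀ μ : Fin 4, (i μ = 1 → (μ.val < 2 → s μ ∈ Γl) ∧ (2 ≤ μ.val → s μ ∈ Γr)) ∧ (i μ = 0 → s μ = (0, 0))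

/-- **Definition I.13 (i)**: for `f` on `𝔜_{i₁,Σ} × 𝔜_{i₂,Σ} × 𝔜_{i₃,Σ'} × 𝔜_{i₄,Σ'}` and multi-indices
`(δ_l, δ_c, δ_r)`, `‖f‖^{(δ_l,δ_c,δ_r)}_{Σ,Σ'} = max_{labels} sup_{momenta} max_{μ ∈ {1,2}, μ' ∈ {3,4}}
‖D^{δ_l}_{1;2} D^{δ_c}_{μ;μ'} D^{δ_r}_{3;4} f‖_{1,∞}` (the `L¹–L^∞` norm over all spatial arguments).
`PHL.D.l1linf` · FKT-PHL Definition I.13 (i) · p.7 L43–59.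
[cite: FeldmanKnorrerTrubowitz2004Ladders, Definition I.13 (i) (p.7 L43–59)] -/
def legNorm (Γl Γr : Finset Arc) (i : LegKind) (δl δc δr : Fin 3 → ℕ)
    (g : (Fin 4 → SpT) → (Fin 4 → Arc) → ℂ) : ℝ≥0∞ :=
  ⨆ (s : Fin 4 → Arc) (_ : AdmissibleLabels Γl Γr i s), ⨆ (k : Fin 4 → SpT),
    ⨆ (μ : Fin 4) (_ : μ = 0 ∨ μ = 1), ⨆ (μ' : Fin 4) (_ : μ' = 2 ∨ μ' = 3),
      l1linfLegs i (diffDecay i 0 1 δl (diffDecay i μ μ' δc (diffDecay i 2 3 δr fun y => g y s))) k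

/-- **Definition I.13 (ii)**: for `f` on `𝔜⁽⁴⁾_{Σ,Σ'}`,
`‖f‖^{(δ_l,δ_c,δ_r)}_{Σ,Σ'} = Σ_{i ∈ {0,1}⁴} ‖f|_{(i₁,…,i₄)}‖^{(δ_l,δ_c,δ_r)}_{Σ,Σ'}`. `PHL.D.l1linf` · FKT-PHL
Definition I.13 (ii) · p.7 L61–68. [cite: FeldmanKnorrerTrubowitz2004Ladders, Definition I.13 (ii) (p.7 L61–68)] -/
def fourNormCoeff (Γl Γr : Finset Arc) (δl δc δr : Fin 3 → ℕ) (f : FourLegFn) : ℝ≥0∞ :=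
  ∑ i : LegKind, legNorm Γl Γr i δl δc δr (f i)

/-- The space `𝔑₃` of formal power series `X = Σ_δ X_δ t^δ` in `t = (t₀,t₁,t₂)` with coefficients
`X_δ ∈ ℝ₊ ∪ {∞}` (p.7 L77–82; Definition of [FKTf2]/[FKTo1]), ordered coefficientwise (the `Pi` order).
`PHL.D.normdom` · FKT-PHL §I.5 · p.7 L77–82. [cite: FeldmanKnorrerTrubowitz2004Ladders, §I.5 (p.7 L77–82)] -/
abbrev FPS3 : Type := (Fin 3 → ℕ) → ℝ≥0∞

/-- The set `Δ = {δ : δ₀ ≤ r₀, δ₁ + δ₂ ≤ r_e}` of controlled multi-indices ((II.4) `\eqnLADDelta`, p.12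
L142–149; it is the index set of the finite coefficients of `𝔠_j`). `PHL.D.normdom` · FKT-PHL (II.4) ·
p.12 L142–149. [cite: FeldmanKnorrerTrubowitz2004Ladders, (II.4) (p.12 L142–149)] -/
def DeltaSet (re r0 : ℕ) : Set (Fin 3 → ℕ) := {δ | δ 0 ≤ r0 ∧ δ 1 + δ 2 ≤ re}

/-- **(I.17)** `𝔠_j = Σ_{δ₁+δ₂ ≤ r_e, δ₀ ≤ r₀} M^{j|δ|} t^δ + Σ_{other δ} ∞ t^δ ∈ 𝔑₃`, the power counting
of derivatives at scale `j`. `PHL.D.normdom` · FKT-PHL (I.17) `\eqnLADcj` · p.7 L84–89.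
[cite: FeldmanKnorrerTrubowitz2004Ladders, (I.17) (p.7 L84–89)] -/
def cWeight (M : ℝ) (re r0 : ℕ) (j : ℕ) : FPS3 := fun δ =>
  if δ 0 ≤ r0 ∧ δ 1 + δ 2 ≤ re then ENNReal.ofReal (M ^ (j * multiDeg δ)) else ⊤

/-- **Definition I.14 (i)**: `‖A‖_{1,Σ} = Σ_δ (1/δ!) ‖A‖^δ_{1,Σ} t^δ ∈ 𝔑₃` for `A` on `((ℝ × ℝ²) × Σ)²`.
`PHL.D.normdom` · FKT-PHL Definition I.14 (i) · p.7 L91–97.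
[cite: FeldmanKnorrerTrubowitz2004Ladders, Definition I.14 (i) (p.7 L91–97)] -/
def twoLegNorm (Γ : Finset Arc) (A : TwoLegFn) : FPS3 := fun δ =>
  ((multiFactorial δ : ℝ≥0∞))⁻¹ * twoLegNormCoeff Γ δ A

/-- **Definition I.14 (ii)**: for `f` on `𝔜⁴_Σ = 𝔜⁽⁴⁾_{Σ,Σ}`,
`‖f‖_Σ = Σ_δ (1/δ!) (max_{δ_l+δ_c+δ_r = δ} ‖f‖^{(δ_l,δ_c,δ_r)}_{Σ,Σ}) t^δ ∈ 𝔑₃`. `PHL.D.normdom` · FKT-PHL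
Definition I.14 (ii) · p.7 L99–106. [cite: FeldmanKnorrerTrubowitz2004Ladders, Definition I.14 (ii) (p.7 L99–106)] -/
def fourNorm (Γ : Finset Arc) (f : FourLegFn) : FPS3 := fun δ =>
  ((multiFactorial δ : ℝ≥0∞))⁻¹ *
    ⨆ (δl : Fin 3 → ℕ) (δc : Fin 3 → ℕ) (δr : Fin 3 → ℕ) (_ : δl + δc + δr = δ),
      fourNormCoeff Γ Γ δl δc δr f

/-- **Definition I.14 (iii)**: for `f` on `(𝔜^↕_Σ)⁴`, `‖f‖_Σ = Σ_{σ₁,…,σ₄} ‖f(·σ₁,…,·σ₄)‖_Σ`.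
`PHL.D.normdom` · FKT-PHL Definition I.14 (iii) · p.7 L108–114.
[cite: FeldmanKnorrerTrubowitz2004Ladders, Definition I.14 (iii) (p.7 L108–114)] -/
def spinFourNorm (Γ : Finset Arc) (F : SpinFourLegFn) : FPS3 := fun δ =>
  ∑ σ : Fin 4 → Spin, fourNorm Γ (F σ) δ

/-! ### §I.6 The propagators -/

/-- **§I.6**: `C_v^{(j)}(k) = ν^{(j)}(k) / (ik₀ - e(𝐤) - v(k))`, the single-scale propagator with the
(self-energy-like) correction `v`. `PHL.D.phladder` · FKT-PHL §I.6 · p.8 L1–6.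
[cite: FeldmanKnorrerTrubowitz2004Ladders, §I.6 (p.8 L1–6)] -/
def propScale (v : SpT → ℂ) (j : ℕ) (k : SpT) : ℂ :=
  (scaleFn S e j k : ℂ) / (Complex.I * (k.1 : ℂ) - (e k.2 : ℂ) - v k)

/-- **§I.6**: `C_v^{(≥ j)}(k) = ν^{(≥ j)}(k) / (ik₀ - e(𝐤) - v(k))`. `PHL.D.phladder` · FKT-PHL §I.6 · p.8
L1–6. [cite: FeldmanKnorrerTrubowitz2004Ladders, §I.6 (p.8 L1–6)] -/
def propScaleGe (v : SpT → ℂ) (j : ℕ) (k : SpT) : ℂ :=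
  (nbhdFn S e j k : ℂ) / (Complex.I * (k.1 : ℂ) - (e k.2 : ℂ) - v k)

/-- **§I.6**, position-space form of a propagator: `C(x,y) = ∫ d³k/(2π)³ e^{i⟨k,x-y⟩_-} C(k)`.
`PHL.D.phladder` · FKT-PHL §I.6 · p.8 L7–17. [cite: FeldmanKnorrerTrubowitz2004Ladders, §I.6 (p.8 L7–17)] -/
def toPosition (C : SpT → ℂ) : Propagator := fun x y =>
  ((2 * Real.pi) ^ (3 : ℕ) : ℂ)⁻¹ * ∫ k : SpT, Complex.exp (Complex.I * (mink k (x - y) : ℂ)) * C k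

/-- The particle–hole bubble propagator of scale `j`, `𝒞^{(j)} = 𝒞(C_v^{(j)}, C_v^{(≥ j+1)})`
(Definition I.20, p.8 L153; (II.2) p.9 L89–94). `PHL.D.cmpladder` · FKT-PHL Definition I.20 · p.8 L153.
[cite: FeldmanKnorrerTrubowitz2004Ladders, Definition I.20 (p.8 L153)] -/
def bubbleScale (v : SpT → ℂ) (j : ℕ) : BubblePropagator :=
  bubbleC (toPosition (propScale S e v j)) (toPosition (propScaleGe S e v (j + 1)))

/-! ### §I.7 Resectorization: the fixed data (`PHL.D.resect`) -/

/-- `χ̂_s(x) = ∫ e^{-i⟨k,x⟩_-} χ_s(k) d³k/(2π)³`, the Fourier transform of a sector partition function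
(p.8 L34–38). `PHL.D.resect` · FKT-PHL §I.7 · p.8 L34–38.
[cite: FeldmanKnorrerTrubowitz2004Ladders, §I.7 (p.8 L34–38)] -/
def chiHat (χ : SpT → ℝ) (x : SpT) : ℂ :=
  ((2 * Real.pi) ^ (3 : ℕ) : ℂ)⁻¹ * ∫ k : SpT, Complex.exp (-(Complex.I * (mink k x : ℂ))) * (χ k : ℂ)

/-- **The fixed data of §I** (p.4 L85–92, p.8 L29–33): the dispersion relation `e` with its regularity
indices `r_e, r₀`, the scale data `(M, φ)`, the sector exponent `ℵ` (`𝔩_j = M^{-ℵ j}`), the Fermi-curve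
frame (intervals, `π_F`), and for each `j ≥ 1` a sectorization `Σ_j` and a partition of unity
`{χ_s : s ∈ Σ_j}` of the `j`-th neighbourhood.  Properties: `LadderData.Admissible`. `PHL.D.resect` ·
FKT-PHL §I.7 · p.8 L29–33. [cite: FeldmanKnorrerTrubowitz2004Ladders, §I.2 (p.4 L85–92) and §I.7 (p.8 L29–33)] -/
structure LadderData where
  /-- the dispersion relation `e(𝐤)`, chemical potential absorbed -/
  e : (Fin 2 → ℝ) → ℝ
  /-- `e ∈ C^{r_e + 3}`, `r_e ≥ 6` -/
  re : ℕ
  /-- number of controlled `k₀`-derivatives, `r₀ ≥ 6` -/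
  r0 : ℕ
  /-- scale parameter `M` and bump `φ` -/
  S : ScaleData
  /-- sector-length exponent, `𝔩_j = M^{-ℵ j}`, `1/2 < ℵ < 2/3` -/
  aleph : ℝ
  /-- intervals on the Fermi curve and the projection `π_F` -/
  fr : FermiFrame
  /-- the sectorization `Σ_j` of length `𝔩_j` at scale `j` (`j ≥ 1`) -/
  Sig : ℕ → Finset Arc
  /-- the partition of unity `χ_s`, `s ∈ Σ_j`, of the `j`-th neighbourhood -/
  χ : ℕ → Arc → SpT → ℝ

/-- `𝔩_j = M^{-ℵ j}`, the sector length at scale `j` (p.8 L29). `PHL.D.resect` · FKT-PHL §I.7 · p.8 L29.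
[cite: FeldmanKnorrerTrubowitz2004Ladders, §I.7 (p.8 L29)] -/
def LadderData.secLen (D : LadderData) (j : ℕ) : ℝ := (D.S.M ^ (D.aleph * j))⁻¹

/-- The `L¹` decay norm of `χ̂_s` required by "[the partition of unity] fulfills Lemma XII.3 of [FKTo3]"
(p.8 L31–33): part (iii) of that Lemma ([FKTo3] p.3 L62–68), `‖χ̂_s‖_{1,∞} ≤ const 𝔠_{j-1} (≤ const 𝔠_j)`, i.e. for every
controlled multi-index `δ ∈ Δ`, `(1/δ!) ∫ |x^δ χ̂_s(x)| d³x ≤ const M^{(j-1)|δ|}` (used in §II as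
`‖x^β χ̂_s‖_{L¹} ≤ const M^{|β|j}`, `\eqnLADchisbnd`, p.13 L91–96 — the only property of `χ_s` used besides (i)). [cite: FeldmanKnorrerTrubowitz2004Ladders, §I.7 (p.8 L29–33) and (p.13 L91–96)] -/
def ChiDecayBound (D : LadderData) (cst : ℝ) : Prop :=
  ∀ j : ℕ, 1 ≤ j → ∀ s ∈ D.Sig j, ∀ δ ∈ DeltaSet D.re D.r0,
    ((multiFactorial δ : ℝ≥0∞))⁻¹ * ∫⁻ x : SpT, ‖(monomial δ x : ℂ) * chiHat (D.χ j s) x‖₊ ≤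
      ENNReal.ofReal (cst * D.S.M ^ ((j - 1) * multiDeg δ))

/-- **The standing assumptions of §I on the fixed data**, as a predicate (never asserted):
the dispersion hypotheses (p.4 L85–89); admissible scale data; `1/2 < ℵ < 2/3` (p.8 L29); an
admissible Fermi-curve frame; for each `j ≥ 1`, `Σ_j` is a sectorization of length `𝔩_j = M^{-ℵj}` at
scale `j` (p.8 L30–31) and `{χ_s}_{s ∈ Σ_j}` is a `[0,1]`-valued partition of unity of the `j`-th
neighbourhood with `χ_s` supported in the extended sector `s̃` and with the `L¹` decay bounds of [FKTo3]
Lemma XII.3 (p.8 L31–33). `PHL.D.resect` · FKT-PHL §I.2/§I.7 · p.4 L85–92, p.8 L29–33.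
[cite: FeldmanKnorrerTrubowitz2004Ladders, §I.2 (p.4 L85–92) and §I.7 (p.8 L29–33)] -/
structure LadderData.Admissible (D : LadderData) : Prop where
  dispersion : DispersionHyp D.e D.re D.r0
  scale : D.S.Admissible
  aleph_gt : 1 / 2 < D.aleph
  aleph_lt : D.aleph < 2 / 3
  frame : D.fr.Admissible D.S D.e D.re
  sectorization : ∀ j : ℕ, 1 ≤ j → IsSectorization D.S D.e D.fr j (D.secLen j) (D.Sig j)
  chi_mem_Icc : ∀ (j : ℕ) (s : Arc) (k : SpT), D.χ j s k ∈ Set.Icc (0 : ℝ) 1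
  chi_support : ∀ j : ℕ, 1 ≤ j → ∀ s ∈ D.Sig j,
    Function.support (D.χ j s) ⊆ extSector D.S D.e D.fr j s
  chi_sum : ∀ j : ℕ, 1 ≤ j → ∀ k ∈ nbhd D.S D.e j, ∑ s ∈ D.Sig j, D.χ j s k = 1
  chi_decay : ∃ cst : ℝ, ChiDecayBound D cst

variable (D : LadderData)

/-- **Definition I.18 (i)**: the `j'`-resectorization of a two-legged sectorized function given on
`Σ_j`-sectors, `p_{Σ_{j'}}((x₁,s₁),(x₂,s₂)) = Σ_{s'₁,s'₂ ∈ Σ_j} ∫ dx'₁dx'₂ χ̂_{s₁}(x₁-x'₁)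
p((x'₁,s'₁),(x'₂,s'₂)) χ̂_{s₂}(x'₂-x₂)` for `j' ≠ j`, and `p_{Σ_j} = p`. `PHL.D.resect` · FKT-PHL
Definition I.18 (i) · p.8 L40–54. [cite: FeldmanKnorrerTrubowitz2004Ladders, Definition I.18 (i) (p.8 L40–54)] -/
def resectTwo (j j' : ℕ) (p : TwoLegFn) : TwoLegFn := fun x s =>
  if j' = j then p x s
  else
    ∑ s'₁ ∈ D.Sig j, ∑ s'₂ ∈ D.Sig j,
      ∫ x' : Fin 2 → SpT,
        chiHat (D.χ j' (s 0)) (x 0 - x' 0) * p x' ![s'₁, s'₂] * chiHat (D.χ j' (s 1)) (x' 1 - x 1)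

/-- **Definition I.18 (ii)–(iii)**: the `(j'_l, j'_r)`-resectorization of a sectorized, translation
invariant `f` given on `𝔜⁽⁴⁾_{Σ_{j_l},Σ_{j_r}}`: on the set `S` of position legs whose side changes scale
(left legs if `j'_l ≠ j_l`, right legs if `j'_r ≠ j_r`) the old labels are summed over `Σ_{j_l}` resp.
`Σ_{j_r}` and the positions convolved with `χ̂_{s_μ}((-1)^{b_μ}(x_μ - x'_μ))` at the new scale; the other
legs are untouched. `PHL.D.resect` · FKT-PHL Definition I.18 (ii)–(iii) · p.8 L55–93.
[cite: FeldmanKnorrerTrubowitz2004Ladders, Definition I.18 (ii)–(iii) (p.8 L55–93)] -/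
def resectFour (jl jr jl' jr' : ℕ) (f : FourLegFn) : FourLegFn := fun i y s =>
  let chg : Fin 4 → Prop := fun μ => i μ = 1 ∧ ((μ.val < 2 ∧ jl' ≠ jl) ∨ (2 ≤ μ.val ∧ jr' ≠ jr))
  let oldSig : Fin 4 → Finset Arc := fun μ => if μ.val < 2 then D.Sig jl else D.Sig jr
  let newScale : Fin 4 → ℕ := fun μ => if μ.val < 2 then jl' else jr'
  ∑ s' ∈ Fintype.piFinset (fun μ => if chg μ then oldSig μ else {s μ}),
    ∫ x' : ({μ : Fin 4 // chg μ} → SpT),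
      (∏ μ : {μ : Fin 4 // chg μ},
          chiHat (D.χ (newScale μ.1) (s μ.1)) (((-1 : ℝ) ^ bExp μ.1) • (y μ.1 - x' μ))) *
        f i (fun μ => if h : chg μ then x' ⟨μ, h⟩ else y μ) s'

/-- **Definition I.18 (iv)**: resectorization of a function on `(𝔜^↕_{Σ_j})⁴`, spin component by spin
component; `resectSpin D j j'` takes `Σ_j`-sectorized functions to `Σ_{j'}`-sectorized ones on both sides.
`PHL.D.resect` · FKT-PHL Definition I.18 (iv) · p.8 L94–105.
[cite: FeldmanKnorrerTrubowitz2004Ladders, Definition I.18 (iv) (p.8 L94–105)] -/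
def resectSpin (j j' : ℕ) (F : SpinFourLegFn) : SpinFourLegFn := fun σ => resectFour D j j j' j' (F σ)

/-! ### §I.8 Compound particle–hole ladders (`PHL.D.cmpladder`) -/

/-- **(I.19)** the flipped function `K^f(z₁,z₂,z₃,z₄) = -K(z₁,z₃,z₂,z₄)` (legs 2 and 3 exchanged together
with their kinds, labels and spins). `PHL.D.cmpladder` · FKT-PHL (I.19) `\eqnLADflipped` · p.8 L129–133.
[cite: FeldmanKnorrerTrubowitz2004Ladders, (I.19) (p.8 L129–133)] -/
def flipFn (K : SpinFourLegFn) : SpinFourLegFn := fun σ i y s =>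
  -K (σ ∘ Equiv.swap (1 : Fin 4) 2) (i ∘ Equiv.swap (1 : Fin 4) 2) (y ∘ Equiv.swap (1 : Fin 4) 2)
      (s ∘ Equiv.swap (1 : Fin 4) 2)

/-- **Definition I.20**, the compound particle–hole ("wrong way") ladders up to scale `j`,
`ℒ^{(j)} = ℒ^{(j)}_v(F⃗)` for a sequence `F⃗ = (F^{(2)}, F^{(3)}, …)` of functions `F^{(i)}` on
`(𝔜^↕_{Σ_i})⁴` and a function `v` on `𝔐`: `ℒ^{(0)} = 0`,
`ℒ^{(j+1)} = ℒ^{(j)}_{Σ_j} + Σ_{ℓ ≥ 1} (F + ℒ^{(j)}_{Σ_j} + ℒ^{(j)f}_{Σ_j}) • 𝒞^{(j)} • ⋯ • 𝒞^{(j)} •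
(F + ℒ^{(j)}_{Σ_j} + ℒ^{(j)f}_{Σ_j})` with `ℓ` bubble propagators `𝒞^{(j)} = 𝒞(C_v^{(j)}, C_v^{(≥ j+1)})`
and `F = Σ_{i=2}^{j} F^{(i)}_{Σ_j}`; `ℒ^{(j)}` is carried on `Σ_{j-1}`-sectors (`ℒ^{(1)} = ℒ^{(2)} = 0`).  The
sum over `ℓ` is a pointwise `tsum`. `PHL.D.cmpladder` · FKT-PHL Definition I.20 · p.8 L135–155.
[cite: FeldmanKnorrerTrubowitz2004Ladders, Definition I.20 (p.8 L135–155)] -/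
def compoundLadder (F : ℕ → SpinFourLegFn) (v : SpT → ℂ) : ℕ → SpinFourLegFn
  | 0 => 0
  | j + 1 =>
    let Lj : SpinFourLegFn := resectSpin D (j - 1) j (compoundLadder F v j)
    let Ljf : SpinFourLegFn := resectSpin D (j - 1) j (flipFn (compoundLadder F v j))
    let Fs : SpinFourLegFn := ∑ i ∈ Finset.Icc 2 j, resectSpin D i j (F i)
    let G : SpinFourLegFn := Fs + Lj + Ljf
    let C : BubblePropagator := bubbleScale D.S D.e v j
    Lj + fun σ i y s => ∑' n : ℕ, ladder G (List.replicate (n + 1) (D.Sig j, C, D.Sig j, G)) σ i y s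

/-! ### §II.2 Spin independence (`PHL.D.spin`) -/

/-- `f^A` of **Definition II.6**: `f^A(σ₁,…,σ₄) = Σ_τ f(τ₁,…,τ₄) A_{τ₁σ₁} Ā_{τ₂σ₂} Ā_{τ₃σ₃} A_{τ₄σ₄}` for
`A ∈ SU(2)`. `PHL.D.spin` · FKT-PHL Definition II.6 `\defLADspinIndependent` · p.11 L44–55.
[cite: FeldmanKnorrerTrubowitz2004Ladders, Definition II.6 (p.11 L44–55)] -/
def spinRotate (A : Matrix (Fin 2) (Fin 2) ℂ) (F : SpinFourLegFn) : SpinFourLegFn := fun σ i y s =>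
  ∑ τ : Fin 4 → Spin,
    F τ i y s * (A (τ 0) (σ 0) * star (A (τ 1) (σ 1)) * star (A (τ 2) (σ 2)) * A (τ 3) (σ 3))

/-- **Definition II.6**: `f` is (particle–hole) spin independent if `f = f^A` for all `A ∈ SU(2)` (then,
Lemma II.7, `f = ½ f_C δ_{σ₁σ₂}δ_{σ₃σ₄} + f_S [δ_{σ₁σ₃}δ_{σ₂σ₄} - ½ δ_{σ₁σ₂}δ_{σ₃σ₄}]` — charge/spin
representation, not restated). `PHL.D.spin` · FKT-PHL Definition II.6 · p.11 L44–55.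
[cite: FeldmanKnorrerTrubowitz2004Ladders, Definition II.6 (p.11 L44–55)] -/
def IsSpinIndependent (F : SpinFourLegFn) : Prop :=
  ∀ A : Matrix (Fin 2) (Fin 2) ℂ, A ∈ Matrix.specialUnitaryGroup (Fin 2) ℂ → spinRotate A F = F

/-! ### The main theorem and its infrared-limit companion (named facts F-071, F-072) -/

/-- The hypotheses of Theorem I.21 on the sequences `F⃗ = (F^{(i)})_{i ≥ 2}`, `p⃗ = (p^{(i)})_{i ≥ 2}` for a
given `ρ`: `F^{(i)}` sectorized (scale `i`), translation invariant, spin independent on `(𝔜^↕_{Σ_i})⁴`;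
`p^{(i)}` sectorized, translation invariant on `((ℝ × ℝ²) × Σ_i)²`; `‖F^{(i)}‖_{Σ_i} ≤ (ρ/M^{εi}) 𝔠_i`,
`‖p^{(i)}‖_{1,Σ_i} ≤ (ρ 𝔩_i/M^i) 𝔠_i` (coefficientwise in `𝔑₃`), and the renormalisation condition
`p̌^{(i)}(0, 𝐤) = 0` (load-bearing, ref-2 trap (vi)). `PHL.T.main` · FKT-PHL Theorem I.21 hypotheses ·
p.9 L5–17. [cite: FeldmanKnorrerTrubowitz2004Ladders, Theorem I.21 (p.9 L5–17)] -/
structure LadderInput (D : LadderData) (ε ρ : ℝ) (F : ℕ → SpinFourLegFn) (p : ℕ → TwoLegFn) :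
    Prop where
  sectorized_F : ∀ i : ℕ, 2 ≤ i → IsSectorizedSpin D.S D.e D.fr i i (F i)
  translationInvariant_F : ∀ i : ℕ, 2 ≤ i → IsTranslationInvariantSpin (F i)
  spinIndependent_F : ∀ i : ℕ, 2 ≤ i → IsSpinIndependent (F i)
  sectorized_p : ∀ i : ℕ, 2 ≤ i → TwoLeg.IsSectorized D.S D.e D.fr i (p i)
  translationInvariant_p : ∀ i : ℕ, 2 ≤ i → TwoLeg.IsTranslationInvariant (p i)
  norm_F : ∀ i : ℕ, 2 ≤ i →
    spinFourNorm (D.Sig i) (F i) ≤ fun δ => ENNReal.ofReal (ρ / D.S.M ^ (ε * i)) * cWeight D.S.M D.re D.r0 i δ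
  norm_p : ∀ i : ℕ, 2 ≤ i →
    twoLegNorm (D.Sig i) (p i) ≤ fun δ =>
      ENNReal.ofReal (ρ * D.secLen i / D.S.M ^ i) * cWeight D.S.M D.re D.r0 i δ
  renorm_p : ∀ i : ℕ, 2 ≤ i → ∀ q : Fin 2 → ℝ, twoLegFT (D.Sig i) (p i) ((0 : ℝ), q) = 0

/-- `v(k) = Σ_{i ≥ 2} p̌^{(i)}(k)` (Theorem I.21, p.9 L18–19; pointwise `tsum`). `PHL.T.main` · FKT-PHL
Theorem I.21 · p.9 L18–19. [cite: FeldmanKnorrerTrubowitz2004Ladders, Theorem I.21 (p.9 L18–19)] -/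
def vOf (p : ℕ → TwoLegFn) (k : SpT) : ℂ := ∑' i : ℕ, if 2 ≤ i then twoLegFT (D.Sig i) (p i) k else 0

/-- **Theorem I.21 (`\thmLADmodcompLadder`, the MAIN THEOREM; = Theorem `\theoremmodcompLadder` of
[FKTf3] by Remark I.23)**, as printed: under the standing assumptions of §I, for every `ε > 0` there are
constants `ρ₀, const` (depending only on the dispersion relation and `M` — here: on the fixed data — and
NOT on the scale `j`) such that for all sequences `F⃗, p⃗` satisfying the hypotheses `LadderInput` with
some `ρ ≤ ρ₀`, and `v = Σ_{i ≥ 2} p̌^{(i)}`, one has for all `j ≥ 1`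
`‖ℒ^{(j+1)}_v(F⃗)‖_{Σ_j} ≤ const ρ² 𝔠_j`.
Compound particle–hole ladders are quadratically small UNIFORMLY IN THE SCALE ("C1's gain in print").
Zero temperature, `d = 2`, strictly convex Fermi curve, no asymmetry hypothesis.  A named fact (D-0014,
licence F-071); nothing here is instantiated at the Hubbard model. `PHL.T.main` · FKT-PHL Theorem I.21 ·
p.9 L1–24. [cite: FeldmanKnorrerTrubowitz2004Ladders, Theorem I.21 (p.9 L1–24)] -/
def CompoundLadderBound : Prop :=
  ∀ D : LadderData, D.Admissible → ∀ ε : ℝ, 0 < ε →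
    ∃ ρ₀ : ℝ, 0 < ρ₀ ∧ ∃ cst : ℝ, 0 < cst ∧
      ∀ (ρ : ℝ) (F : ℕ → SpinFourLegFn) (p : ℕ → TwoLegFn), 0 ≤ ρ → ρ ≤ ρ₀ → LadderInput D ε ρ F p →
        ∀ j : ℕ, 1 ≤ j →
          spinFourNorm (D.Sig j) (compoundLadder D F (vOf D p) (j + 1)) ≤
            fun δ => ENNReal.ofReal (cst * ρ ^ 2) * cWeight D.S.M D.re D.r0 j δ

/-- The value of the compound ladder at external momenta (all four legs momentum legs, `i = 0`):
`ℒ^{(j)}_v(F⃗)|_{i₁=i₂=i₃=i₄=0}((q + t/2, σ₁), (q - t/2, σ₂), (q' + t/2, σ₃), (q' - t/2, σ₄))` with transfer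
momentum `t` — a point of the momentum-conservation surface `k₁-k₂ = k₃-k₄ (= t)`, where the all-momentum
component of each ladder is the `(2π)³ δ`-pinned density of Definition I.7 (iii) (`linkPinned`; rev. 2,
F-072). `PHL.T.cont` · FKT-PHL Theorem I.22 · p.9 L58–65.
[cite: FeldmanKnorrerTrubowitz2004Ladders, Theorem I.22 (p.9 L58–65)] -/
def ladderAtMomenta (F : ℕ → SpinFourLegFn) (v : SpT → ℂ) (j : ℕ) (q q' t : SpT)
    (σ : Fin 4 → Spin) : ℂ :=
  compoundLadder D F v j σ (fun _ => 0)
    ![q + (2 : ℝ)⁻¹ • t, q - (2 : ℝ)⁻¹ • t, q' + (2 : ℝ)⁻¹ • t, q' - (2 : ℝ)⁻¹ • t] (fun _ => (0, 0))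

/-- **Theorem I.22 (`\thmLADmodcompLaddercont`)**, as printed: under the hypotheses of Theorem I.21, the
limit `𝔏(q,q',t,σ₁,…,σ₄) = lim_{j → ∞} ℒ^{(j)}_v(F⃗)|_{i=0}((q+t/2,σ₁),(q-t/2,σ₂),(q'+t/2,σ₃),(q'-t/2,σ₄))`
exists for transfer momentum `t ≠ 0` and is continuous in `(q,q',t)` for `t ≠ 0`; the restrictions to
`𝐭 = 0` and to `t₀ = 0`, `𝔏(q,q',(t₀,0),σ)` and `𝔏(q,q',(0,𝐭),σ)`, have continuous extensions to `t = 0`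
(TWO one-sided extensions — their inequality is the particle–hole discontinuity at zero transfer, p.3;
ref-2 trap (iv)). Named fact (licence F-072). `PHL.T.cont` · FKT-PHL Theorem I.22 · p.9 L56–71.
[cite: FeldmanKnorrerTrubowitz2004Ladders, Theorem I.22 (p.9 L56–71)] -/
def CompoundLadderInfraredLimit : Prop :=
  ∀ D : LadderData, D.Admissible → ∀ ε : ℝ, 0 < ε →
    ∃ ρ₀ : ℝ, 0 < ρ₀ ∧
      ∀ (ρ : ℝ) (F : ℕ → SpinFourLegFn) (p : ℕ → TwoLegFn), 0 ≤ ρ → ρ ≤ ρ₀ → LadderInput D ε ρ F p →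
        ∃ L : SpT → SpT → SpT → (Fin 4 → Spin) → ℂ,
          (∀ (q q' t : SpT) (σ : Fin 4 → Spin), t ≠ 0 →
              Tendsto (fun j : ℕ => ladderAtMomenta D F (vOf D p) j q q' t σ) atTop (𝓝 (L q q' t σ))) ∧
          (∀ σ : Fin 4 → Spin,
              ContinuousOn (fun w : SpT × SpT × SpT => L w.1 w.2.1 w.2.2 σ) {w | w.2.2 ≠ 0}) ∧
          (∀ σ : Fin 4 → Spin, ∃ L₁ : SpT × SpT × ℝ → ℂ, Continuous L₁ ∧
              ∀ (q q' : SpT) (t₀ : ℝ), t₀ ≠ 0 → L₁ (q, q', t₀) = L q q' (t₀, 0) σ) ∧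
          (∀ σ : Fin 4 → Spin, ∃ L₂ : SpT × SpT × (Fin 2 → ℝ) → ℂ, Continuous L₂ ∧
              ∀ (q q' : SpT) (τ : Fin 2 → ℝ), τ ≠ 0 → L₂ (q, q', τ) = L q q' (0, τ) σ)

/-! ### §II.3–II.4 Scaled norms, the top/middle/bottom split, and the Bubble Bound (F-076; F-075) -/

/-- **Convention II.12 / Definition II.13**: for `f` on `𝔜_{ℓ,r} = 𝔜⁽⁴⁾_{Σ_ℓ,Σ_r}`,
`‖f‖^{(δ_l,δ_c,δ_r)}_{ℓ,r} = M^{-(ℓ|δ_l| + |δ_c| max(ℓ,r) + r|δ_r|)} ‖f‖^{(δ_l,δ_c,δ_r)}_{Σ_ℓ,Σ_r}`.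
`PHL.S.repnorm` · FKT-PHL Definition II.13 `\secrepnorm` · p.12 L117–122.
[cite: FeldmanKnorrerTrubowitz2004Ladders, Definition II.13 (p.12 L117–122)] -/
def scaledNorm (l r : ℕ) (δl δc δr : Fin 3 → ℕ) (f : FourLegFn) : ℝ≥0∞ :=
  ENNReal.ofReal ((D.S.M ^ (l * multiDeg δl + multiDeg δc * max l r + r * multiDeg δr))⁻¹) *
    fourNormCoeff (D.Sig l) (D.Sig r) δl δc δr f

/-- **Definition II.13**: `|f|^{[δ_l,δ_c,δ_r]}_{ℓ,r} = max_{δ'_l ≤ δ_l, δ'_c ≤ δ_c, δ'_r ≤ δ_r} ‖f‖^{(δ'_l,δ'_c,δ'_r)}_{ℓ,r}`.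
`PHL.S.repnorm` · FKT-PHL Definition II.13 · p.12 L123–129.
[cite: FeldmanKnorrerTrubowitz2004Ladders, Definition II.13 (p.12 L123–129)] -/
def scaledNormMax (l r : ℕ) (δl δc δr : Fin 3 → ℕ) (f : FourLegFn) : ℝ≥0∞ :=
  ⨆ (δl' : Fin 3 → ℕ) (_ : δl' ≤ δl), ⨆ (δc' : Fin 3 → ℕ) (_ : δc' ≤ δc),
    ⨆ (δr' : Fin 3 → ℕ) (_ : δr' ≤ δr), scaledNorm D l r δl' δc' δr' f

/-- **Definition II.15 (Norms and Resectorization)**: for `f` sectorized on `𝔜_{ℓ',r'}`,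
`|f|^{[δ⃗]}_{ℓ,r} = |f_{Σ_ℓ,Σ_r}|^{[δ⃗]}_{ℓ,r}` (resectorize, then measure). `PHL.S.repnorm` · FKT-PHL
Definition II.15 `\resecrepnorm` · p.13 L1–9. [cite: FeldmanKnorrerTrubowitz2004Ladders, Definition II.15 (p.13 L1–9)] -/
def resectScaledNormMax (l' r' l r : ℕ) (δl δc δr : Fin 3 → ℕ) (f : FourLegFn) : ℝ≥0∞ :=
  scaledNormMax D l r δl δc δr (resectFour D l' r' l r f)

/-- **Lemma II.16 (`\lemLADresectornorm`)**, as printed (wave-optional licence F-075): for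
`ℓ ≥ ℓ' ≥ 1`, `r ≥ r' ≥ 1`, `f` sectorized, translation invariant on `𝔜_{ℓ',r'}` and `δ⃗ ∈ Δ⃗`
(`δ_l + δ_c + δ_r ∈ Δ`): `|f|^{[δ⃗]}_{ℓ,r} ≤ const { M^{-(ℓ-ℓ')}M^{-(r-r')} |f|^{[δ⃗]}_{ℓ',r'}
+ M^{-(ℓ-ℓ')} |f|^{[δ_l,δ_c,0]}_{ℓ',r'} + M^{-(r-r')} |f|^{[0,δ_c,δ_r]}_{ℓ',r'} + |f|^{[0,δ_c,0]}_{ℓ',r'} }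
≤ const |f|^{[δ⃗]}_{ℓ',r'}`, the constant depending only on `Δ` (and the fixed data). Named fact.
`PHL.S.repnorm` · FKT-PHL Lemma II.16 · p.13 L19–33.
[cite: FeldmanKnorrerTrubowitz2004Ladders, Lemma II.16 (p.13 L19–33)] -/
def ResectorizationNormBound : Prop :=
  ∀ D : LadderData, D.Admissible → ∃ cst : ℝ, 0 < cst ∧
    ∀ (l l' r r' : ℕ), 1 ≤ l' → l' ≤ l → 1 ≤ r' → r' ≤ r →
      ∀ (δl δc δr : Fin 3 → ℕ), δl + δc + δr ∈ DeltaSet D.re D.r0 →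
        ∀ f : FourLegFn, IsSectorized D.S D.e D.fr l' r' f → IsTranslationInvariant f →
          resectScaledNormMax D l' r' l r δl δc δr f ≤
              ENNReal.ofReal cst *
                (ENNReal.ofReal ((D.S.M ^ (l - l'))⁻¹ * (D.S.M ^ (r - r'))⁻¹) *
                    scaledNormMax D l' r' δl δc δr f +
                  ENNReal.ofReal ((D.S.M ^ (l - l'))⁻¹) * scaledNormMax D l' r' δl δc 0 f +
                  ENNReal.ofReal ((D.S.M ^ (r - r'))⁻¹) * scaledNormMax D l' r' 0 δc δr f +
                  scaledNormMax D l' r' 0 δc 0 f) ∧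
            resectScaledNormMax D l' r' l r δl δc δr f ≤
              ENNReal.ofReal cst * scaledNormMax D l' r' δl δc δr f

/-- **Definition II.17 (`\topbottom`)**, the "top" part of `𝒞^{[i,j]} = Σ_{m=i}^{j} 𝒞^{(m)}`:
`𝒞_tp^{[i,j]} = Σ_{i ≤ i_t ≤ j, i_b > j} C_v^{(i_t)} ⊗ C_v^{(i_b)t} = (Σ_{i_t=i}^{j} C_v^{(i_t)}) ⊗ (C_v^{(≥ j+1)})ᵗ`
(closed form of the `i_b`-sum as in (II.2), p.9 L95–100). `PHL.T.bubble` · FKT-PHL Definition II.17 ·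
p.13 L122–135. [cite: FeldmanKnorrerTrubowitz2004Ladders, Definition II.17 (p.13 L122–135)] -/
def bubbleTop (v : SpT → ℂ) (i j : ℕ) : BubblePropagator :=
  tensorBubble (toPosition fun k => ∑ m ∈ Finset.Icc i j, propScale D.S D.e v m k)
    (toPosition (propScaleGe D.S D.e v (j + 1))).transpose

/-- **Definition II.17**: `𝒞_md^{[i,j]} = Σ_{i ≤ i_t ≤ j, i ≤ i_b ≤ j} C_v^{(i_t)} ⊗ C_v^{(i_b)t}`.
`PHL.T.bubble` · FKT-PHL Definition II.17 · p.13 L129–130.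
[cite: FeldmanKnorrerTrubowitz2004Ladders, Definition II.17 (p.13 L122–135)] -/
def bubbleMid (v : SpT → ℂ) (i j : ℕ) : BubblePropagator :=
  tensorBubble (toPosition fun k => ∑ m ∈ Finset.Icc i j, propScale D.S D.e v m k)
    (toPosition fun k => ∑ m ∈ Finset.Icc i j, propScale D.S D.e v m k).transpose

/-- **Definition II.17**: `𝒞_bt^{[i,j]} = Σ_{i_t > j, i ≤ i_b ≤ j} C_v^{(i_t)} ⊗ C_v^{(i_b)t} = C_v^{(≥ j+1)} ⊗ (Σ_{i_b=i}^{j} C_v^{(i_b)})ᵗ`.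
`PHL.T.bubble` · FKT-PHL Definition II.17 · p.13 L131–132.
[cite: FeldmanKnorrerTrubowitz2004Ladders, Definition II.17 (p.13 L122–135)] -/
def bubbleBot (v : SpT → ℂ) (i j : ℕ) : BubblePropagator :=
  tensorBubble (toPosition (propScaleGe D.S D.e v (j + 1)))
    (toPosition fun k => ∑ m ∈ Finset.Icc i j, propScale D.S D.e v m k).transpose

/-- `𝒞^{[i,j]} = Σ_{m=i}^{j} 𝒞^{(m)} = 𝒞_tp^{[i,j]} + 𝒞_md^{[i,j]} + 𝒞_bt^{[i,j]}` ((II.2) p.9 L95–100 and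
Definition II.17). `PHL.T.bubble` · FKT-PHL (II.2)/Definition II.17 · p.9 L95–100, p.13 L122–125.
[cite: FeldmanKnorrerTrubowitz2004Ladders, (II.2) (p.9 L95–100) and Definition II.17 (p.13 L122–125)] -/
def bubbleRange (v : SpT → ℂ) (i j : ℕ) : BubblePropagator :=
  bubbleTop D v i j + bubbleMid D v i j + bubbleBot D v i j

/-- The differential–decay operator `D^β_{μ;μ'} = (x_μ - x_{μ'})^β` acting on a bubble propagator (all four
arguments are positions; Definition I.12 with `i_μ = i_{μ'} = 1`), as in Theorem II.18 (b), (c).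
`PHL.T.bubble` · FKT-PHL Definition I.12/Theorem II.18 · p.7 L31, p.13 L149–160.
[cite: FeldmanKnorrerTrubowitz2004Ladders, Definition I.12 (p.7 L31) and Theorem II.18 (p.13 L149–160)] -/
def bubbleDecay (μ μ' : Fin 4) (β : Fin 3 → ℕ) (P : BubblePropagator) : BubblePropagator :=
  fun x => (monomial β (x μ - x μ') : ℂ) * P x

/-- The propagator corrections `v` admitted in §I.6: `|v(k)| ≤ ½ |ik₀ - e(𝐤)|` (p.8 L6; Definition I.20,
p.8 L138–139). `PHL.D.cmpladder` · FKT-PHL §I.6/Definition I.20 · p.8 L6, L138–139.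
[cite: FeldmanKnorrerTrubowitz2004Ladders, §I.6 (p.8 L6) and Definition I.20 (p.8 L138–139)] -/
def IsSmallCorrection (e : (Fin 2 → ℝ) → ℝ) (v : SpT → ℂ) : Prop :=
  ∀ k : SpT, ‖v k‖ ≤ 2⁻¹ * ‖Complex.I * (k.1 : ℂ) - (e k.2 : ℂ)‖

/-- **Theorem II.18 (`\bbound`, Bubble Bound)**, as printed: let `1 ≤ i, ℓ ≤ j`, `δ_l, δ_r ∈ Δ`, `g` and
`h` sectorized, translation invariant functions on `𝔜_{ℓ,i}` and `𝔜_{i,j}`. Then, with `const` depending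
only on the dispersion relation and `M` (here: the fixed data), and the propagators `C_v` built with the
`v = Σ_{i ≥ 2} p̌^{(i)}` of the sequences `F⃗, p⃗` FIXED "as in Theorem I.21" for the rest of the paper
(§II, p.9 L82–87 — hence the outer quantifiers repeat those of Theorem I.21),
(a) `|g • 𝒞^{[i,j]} • h|^{[δ_l,0,δ_r]}_{ℓ,j} ≤ const · i · max_{|α_r|+|α_l| ≤ 3} |g|^{[δ_l,0,α_r]}_{ℓ,i} |h|^{[α_l,0,δ_r]}_{i,j}`;
(b) for `β ∈ Δ`: `M^{-|β|j} ‖g • D^β_{1;3}𝒞_tp^{[i,j]} • h‖^{(δ_l,0,δ_r)}_{ℓ,j} ≤ const ‖g‖^{(δ_l,0,0)}_{ℓ,i} ‖h‖^{(0,0,δ_r)}_{i,j}`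
and the same with `D^β_{2;4}𝒞_bt^{[i,j]}`;
(c) `‖g • 𝒞_md^{[i,j]} • h‖^{(δ_l,0,δ_r)}_{ℓ,j} ≤ const |j-i+1| ‖g‖^{(δ_l,0,0)}_{ℓ,i} ‖h‖^{(0,0,δ_r)}_{i,j}` and, for
`β ∈ Δ` with `|β| ≥ 1` and `(μ,μ') ∈ {(1,3),(2,4)}`,
`M^{-|β|j} ‖g • D^β_{μ;μ'}𝒞_md^{[i,j]} • h‖^{(δ_l,0,δ_r)}_{ℓ,j} ≤ const ‖g‖^{(δ_l,0,0)}_{ℓ,i} ‖h‖^{(0,0,δ_r)}_{i,j}`.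
The particle–HOLE bubble is bounded uniformly in the scales up to the factor `i` resp. `|j-i+1|` — contrast
the logarithmically divergent particle–particle bubble (tree: `WeakCouplingCeiling.tendsto_cooperLadder_bubble`).
Named fact (licence F-076). `PHL.T.bubble` · FKT-PHL Theorem II.18 · p.13 L137–160, p.14 L1–16.
[cite: FeldmanKnorrerTrubowitz2004Ladders, Theorem II.18 (p.13 L137 – p.14 L16)] -/
def BubbleBound : Prop :=
  ∀ D : LadderData, D.Admissible → ∀ ε : ℝ, 0 < ε →
    ∃ ρ₀ : ℝ, 0 < ρ₀ ∧ ∃ cst : ℝ, 0 < cst ∧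
    ∀ (ρ : ℝ) (F : ℕ → SpinFourLegFn) (p : ℕ → TwoLegFn), 0 ≤ ρ → ρ ≤ ρ₀ → LadderInput D ε ρ F p →
    let v : SpT → ℂ := vOf D p
    ∀ (i l j : ℕ), 1 ≤ i → i ≤ j → 1 ≤ l → l ≤ j →
      ∀ (δl δr : Fin 3 → ℕ), δl ∈ DeltaSet D.re D.r0 → δr ∈ DeltaSet D.re D.r0 →
        ∀ (g h : FourLegFn), IsSectorized D.S D.e D.fr l i g → IsTranslationInvariant g →
          IsSectorized D.S D.e D.fr i j h → IsTranslationInvariant h →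
          -- (a)
          scaledNormMax D l j δl 0 δr (link (D.Sig i) (D.Sig i) g (bubbleRange D v i j) h) ≤
              ENNReal.ofReal (cst * i) *
                ⨆ (αr : Fin 3 → ℕ) (αl : Fin 3 → ℕ) (_ : multiDeg αr + multiDeg αl ≤ 3),
                  scaledNormMax D l i δl 0 αr g * scaledNormMax D i j αl 0 δr h ∧
          -- (b)
          (∀ β ∈ DeltaSet D.re D.r0,
            ENNReal.ofReal ((D.S.M ^ (multiDeg β * j))⁻¹) *
                scaledNorm D l j δl 0 δr (link (D.Sig i) (D.Sig i) g (bubbleDecay 0 2 β (bubbleTop D v i j)) h) ≤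
              ENNReal.ofReal cst * (scaledNorm D l i δl 0 0 g * scaledNorm D i j 0 0 δr h) ∧
            ENNReal.ofReal ((D.S.M ^ (multiDeg β * j))⁻¹) *
                scaledNorm D l j δl 0 δr (link (D.Sig i) (D.Sig i) g (bubbleDecay 1 3 β (bubbleBot D v i j)) h) ≤
              ENNReal.ofReal cst * (scaledNorm D l i δl 0 0 g * scaledNorm D i j 0 0 δr h)) ∧
          -- (c)
          scaledNorm D l j δl 0 δr (link (D.Sig i) (D.Sig i) g (bubbleMid D v i j) h) ≤
              ENNReal.ofReal (cst * ((j : ℝ) - i + 1)) * (scaledNorm D l i δl 0 0 g * scaledNorm D i j 0 0 δr h) ∧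
          (∀ β ∈ DeltaSet D.re D.r0, 1 ≤ multiDeg β → ∀ μμ' ∈ ({(0, 2), (1, 3)} : Set (Fin 4 × Fin 4)),
            ENNReal.ofReal ((D.S.M ^ (multiDeg β * j))⁻¹) *
                scaledNorm D l j δl 0 δr
                  (link (D.Sig i) (D.Sig i) g (bubbleDecay μμ'.1 μμ'.2 β (bubbleMid D v i j)) h) ≤
              ENNReal.ofReal cst * (scaledNorm D l i δl 0 0 g * scaledNorm D i j 0 0 δr h))

end FKTLadders

end Literature.MathematicalPhysics.QuantumLattice.FermiRG
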